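import Literature.Analysis.ValidatedNumerics.KernelData
import Literature.Analysis.ValidatedNumerics.MultiPrecisionInterval
import Literature.MathematicalPhysics.QuantumFieldTheory.ConformalBootstrap3D.BlockZSeries
import Literature.MathematicalPhysics.QuantumFieldTheory.ConformalBootstrap3D.HRCoeffCellBounds
import Literature.MathematicalPhysics.QuantumFieldTheory.ConformalBootstrap3D.PointCertificateTwistGap
import Literature.MathematicalPhysics.QuantumFieldTheory.ConformalBootstrap3D.PointKernelArith
import Literature.MathematicalPhysics.QuantumFieldTheory.ConformalBootstrap3D.PointKernelPowers
import Mathlib.Analysis.SpecialFunctions.Pow.Real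

/-!
# The kernel evaluator for B″ point-certificate table numbers

This file is the second implementation (the Lean kernel; the first is an exact-rational Python
mirror) of the TABLE-NUMBER EVALUATOR of the point-certificate format of
`PointCertificateTwistGap` / `PointCertificateTable`: given a point functional
`α = Σ_k w_k ev_{(z_k, z̄_k)}` with rational nodes and weights and a box
`[slo, shi] × [εlo, E₀)`, it computes — by structural recursion the kernel can run with `decide` —
integer LOWER BOUNDS (at a binary scale `S`) for the table numbers of the rules of
`boxExcluded_of_pointTable_twist`, and proves that nonnegative answers discharge its hypotheses
verbatim:

* (M)  `termCornerBound w z z̄ j E₁ E₂ slo shi` on a row of boxes `[E_{j,m}, E_{j,m+1}]`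
       (`PCert.mBlockOK`, sound by `PCert.mBlockOK_sound`; hypotheses `he`, `hρM`, `hbox` by
       `PCert.ruleM_hyps`);
* (D∞/O2) the head-cell numbers `headNumber w z z̄ ℓ t_{ℓ,k} t_{ℓ,k+1} slo shi n_F bit` of the rows
       `ℓ = 0` and even `ℓ < L`, for BOTH rule bits: corner cells (`headCellBound`, `PCert.cellOK`,
       sound by `PCert.cell_sound`) and chord cells (`headChordBound` = least of the four vertex
       values of the bilinear minorant `termChordBound`, `PCert.cellOKC`, sound by
       `PCert.cell_soundC`, which also delivers the half conditions `hρ` of the cell width);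
       cells are chained along a row in segments (`PCert.hSegOK`, `PCert.hBlockOK`,
       `PCert.hBlockOK_sound`) and the row structure `t_{ℓ,k}`, `K_ℓ`, `n_F`, contiguity and end
       points (`ht0`, `htℓ`, `hlow`, `hnF`) is checked by `PCert.hMetaOK` (`PCert.head_hyps`);
* (S)  `1/2 ≤ v_k^{shi-slo}`, `1/2 ≤ u_k^{shi-slo}` (`PCert.sideOK`, `PCert.side_hyp`);
* (O1) `0 < termCornerBound w z z̄ 0 0 0 slo shi` (`PCert.o1OK`, `PCert.o1_hyp`);
* (T)  the apex bracket with domination ratios `qd, qr` (`PCert.tOK`, `PCert.t_hyps`).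

`PCert.boxExcluded_of_kernel` assembles them: a certificate whose checks evaluate to `true` and
whose head cells / (M) boxes pass the block checkers excludes its box
`QBox slo shi εlo E₀ = [slo, shi] × [εlo, E₀)`.

All real powers `u^e` (`u = z z̄`, `v = (1-z)(1-z̄)`, `e ∈ ℚ_{>0}`) are enclosed in fixed-point
intervals (`NumericsMP.MI`) built from certificate-supplied ROOT ATOMS checked by
`PointKernel.checkRoot` (`PointKernelPowers`), and combined along a row by one interval
multiplication per box / cell (`PCert.stepAll`); reciprocals (chord vertex factors `2 − r⁻¹`) by
`invMI`; the Legendre forms `𝒫_j`, the recursion coefficients `hrCoeff` (row-tabulated) and the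
pivot products are the exact rational mirrors of `PointKernelArith`.  The core estimates are
`PCert.boxLoAux_le_tcb` (a box sum `≤ S ·` the corner bound), `PCert.qLo_le` / `PCert.qLoC_le`
(a head summand `≤ S · min(A ρ Φ, B ρ' Φ)` with `Φ` the corner number, resp. the chord number
`termChordMin`, of the descendant term) and `PCert.tchord_vertex_eq` (the vertex values of the
chord minorant, factorised per node).

No instance data lives here (instances are `PointKernelK34*.lean`-style files that `decide` the
checks of this file on literal certificates and apply `boxExcluded_of_kernel`).

References: Simmons-Duffin, *JHEP* 06 (2015) 174, arXiv:1502.02033, App. A (z-series positivity);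
Hogervorst–Rychkov, arXiv:1303.1111, §2–3, eq. (3.6), (3.9) (radial / Casimir recursion);
El-Showk et al., arXiv:1203.6064, App. C (point functionals); tree files
`PointCertificateTwistGap`, `PointCertificateTable`, `PointFunctionalHead`, `PointFunctionalChord`,
`PointFunctionalTermwise`, `PointKernelArith`, `PointKernelPowers`.
-/


namespace Literature.MathematicalPhysics.QuantumFieldTheory.ConformalBootstrap3D

namespace PointKernel

open Literature.Analysis.ValidatedNumerics (rsum rall vget vtab vget_vtab vget_of_length_le rsum_eq_sum
  rall_eq_true_iff of_rall)
open Literature.Analysis.ValidatedNumerics.NumericsMP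
open Real

/-! ### Small helpers: rational scaling, floors, list access -/

/-- `I · c` for a rational `c` (exact scaling of an interval). [folklore] -/
def mulQ (I : MI) (c : ℚ) : MI := MI.divNat (MI.mulInt I c.num) c.den

/-- [folklore] -/
theorem mem_mulQ {S : ℕ} {x : ℝ} {I : MI} (hx : MI.mem S x I) (c : ℚ) :
    MI.mem S (x * c) (mulQ I c) := by
  have h := MI.mem_divNat (MI.mem_mulInt hx c.num) c.den_pos
  unfold mulQ
  convert h using 1
  rw [Rat.cast_def c]
  ring

/-- `⌊c · L⌋` for `c : ℚ`, `L : ℤ`. [folklore] -/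
def floorMul (c : ℚ) (L : ℤ) : ℤ := c.num * L / (c.den : ℤ)

/-- [folklore] -/
theorem floorMul_le {c : ℚ} (hc : 0 ≤ c) {L : ℤ} {y : ℝ} (h : (L : ℝ) ≤ y) :
    (floorMul c L : ℝ) ≤ (c : ℝ) * y := by
  have hden : (0 : ℝ) < c.den := by exact_mod_cast c.den_pos
  have hnum : (0 : ℝ) ≤ c.num := by exact_mod_cast Rat.num_nonneg.mpr hc
  have h1 : ((floorMul c L : ℤ) : ℝ) * c.den ≤ (c.num : ℝ) * L := by
    have := Int.ediv_mul_le (c.num * L) (b := (c.den : ℤ)) (by exact_mod_cast c.den_pos.ne')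
    unfold floorMul
    exact_mod_cast this
  have h2 : (c : ℝ) = (c.num : ℝ) / c.den := Rat.cast_def c
  rw [h2, div_mul_eq_mul_div, le_div_iff₀ hden]
  calc ((floorMul c L : ℤ) : ℝ) * c.den ≤ (c.num : ℝ) * L := h1
    _ ≤ (c.num : ℝ) * y := mul_le_mul_of_nonneg_left h hnum

/-- Entry `i` of a list of intervals (`[0,0]` beyond the end). [folklore] -/
def miAt (l : List MI) (i : ℕ) : MI := l.getD i ⟨0, 0⟩

/-! ### Certificate data: nodes, weights, atoms -/

/-- One node of a point functional: `(z, z̄)` and its weight. [folklore] -/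
structure NodeQ where
  /-- `z` -/
  z : ℚ
  /-- `z̄` -/
  zb : ℚ
  /-- weight -/
  w : ℚ

/-- The node / atom part of a point certificate. [folklore] -/
structure PCert where
  /-- binary scale of all intervals -/
  S : ℕ
  /-- the nodes -/
  nodes : List NodeQ
  /-- index of the apex node -/
  apex : ℕ
  /-- the external-dimension box `[slo, shi]` -/
  slo : ℚ
  shi : ℚ
  /-- exponents `ρ_t = (num, den)` of the root atoms -/
  rho : List (ℕ × ℕ)
  /-- per node: atoms `∋ u_k^{ρ_t}`, `u_k = z_k z̄_k` -/
  atomsU : List (List MI)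
  /-- per node: atoms `∋ v_k^{ρ_t}`, `v_k = (1-z_k)(1-z̄_k)` -/
  atomsV : List (List MI)
  /-- atom indices of the exponents `slo`, `shi`, `shi - slo` -/
  tslo : ℕ
  tshi : ℕ
  tdel : ℕ

namespace PCert

variable (c : PCert)

/-- number of nodes [folklore] -/
def N : ℕ := c.nodes.length
/-- node `k` (junk beyond `N`) [folklore] -/
def nd (k : ℕ) : NodeQ := c.nodes.getD k ⟨0, 0, 0⟩
/-- `z_k` [folklore] -/
def z (k : ℕ) : ℚ := (c.nd k).z
/-- `z̄_k` [folklore] -/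
def zb (k : ℕ) : ℚ := (c.nd k).zb
/-- `w_k` [folklore] -/
def w (k : ℕ) : ℚ := (c.nd k).w
/-- `u_k = z_k z̄_k` [folklore] -/
def u (k : ℕ) : ℚ := c.z k * c.zb k
/-- `v_k = (1 - z_k)(1 - z̄_k)` [folklore] -/
def v (k : ℕ) : ℚ := (1 - c.z k) * (1 - c.zb k)
/-- `w_k⁺` [folklore] -/
def wp (k : ℕ) : ℚ := max (c.w k) 0
/-- `w_k⁻` [folklore] -/
def wm (k : ℕ) : ℚ := max (-c.w k) 0

/-- the real node vectors of the functional [folklore] -/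
def zR : Fin c.N → ℝ := fun k => ((c.z k : ℚ) : ℝ)
/-- see `zR` [folklore] -/
def zbR : Fin c.N → ℝ := fun k => ((c.zb k : ℚ) : ℝ)
/-- see `zR` [folklore] -/
def wR : Fin c.N → ℝ := fun k => ((c.w k : ℚ) : ℝ)

/-- `∋ u_k^{e(r)}` [folklore] -/
def powU (k : ℕ) (r : PowReq) : MI :=
  evalPow c.S (c.u k).num.toNat (c.u k).den (c.atomsU.getD k []) r
/-- `∋ v_k^{e(r)}` [folklore] -/
def powV (k : ℕ) (r : PowReq) : MI :=
  evalPow c.S (c.v k).num.toNat (c.v k).den (c.atomsV.getD k []) r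
/-- request for the exponent `slo` [folklore] -/
def rSlo : PowReq := ⟨0, 0, c.tslo, 1, 0, 0⟩
/-- request for the exponent `shi` [folklore] -/
def rShi : PowReq := ⟨0, 0, c.tshi, 1, 0, 0⟩

/-- node `k` is admissible and its atoms check. [folklore] -/
def checkNode (k : ℕ) : Bool :=
  decide (0 < c.zb k) && decide (c.zb k ≤ c.z k) && decide (c.z k < 1) &&
    checkAtoms c.S (c.u k).num.toNat (c.u k).den c.rho (c.atomsU.getD k []) &&
    checkAtoms c.S (c.v k).num.toNat (c.v k).den c.rho (c.atomsV.getD k [])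

/-- all node-level checks. [folklore] -/
def checkNodes : Bool :=
  decide (0 < c.S) && rall c.N c.checkNode && decide (atomExp c.rho c.tslo = c.slo) &&
    decide (atomExp c.rho c.tshi = c.shi) && decide (c.apex < c.N) && decide (0 ≤ c.w c.apex) &&
    decide (atomExp c.rho c.tdel = c.shi - c.slo)

section NodeFacts

variable {c} {k : ℕ}

/-- the scale is positive. [folklore] -/
theorem S_pos (h : c.checkNodes = true) : 0 < c.S := by
  simp only [checkNodes, Bool.and_eq_true, decide_eq_true_eq] at h; exact h.1.1.1.1.1.1

/-- each node passes its check. [folklore] -/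
theorem checkNode_of_checkNodes (h : c.checkNodes = true) (hk : k < c.N) : c.checkNode k = true := by
  simp only [checkNodes, Bool.and_eq_true, decide_eq_true_eq] at h; exact of_rall h.1.1.1.1.1.2 hk

/-- atom `tslo` is `slo`. [folklore] -/
theorem tslo_eq (h : c.checkNodes = true) : atomExp c.rho c.tslo = c.slo := by
  simp only [checkNodes, Bool.and_eq_true, decide_eq_true_eq] at h; exact h.1.1.1.1.2

/-- atom `tshi` is `shi`. [folklore] -/
theorem tshi_eq (h : c.checkNodes = true) : atomExp c.rho c.tshi = c.shi := by
  simp only [checkNodes, Bool.and_eq_true, decide_eq_true_eq] at h; exact h.1.1.1.2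

/-- the apex is a node. [folklore] -/
theorem apex_lt (h : c.checkNodes = true) : c.apex < c.N := by
  simp only [checkNodes, Bool.and_eq_true, decide_eq_true_eq] at h; exact h.1.1.2

/-- the apex weight is nonnegative. [folklore] -/
theorem w_apex_nonneg (h : c.checkNodes = true) : 0 ≤ c.w c.apex := by
  simp only [checkNodes, Bool.and_eq_true, decide_eq_true_eq] at h; exact h.1.2

/-- atom `tdel` is `shi - slo`. [folklore] -/
theorem tdel_eq (h : c.checkNodes = true) : atomExp c.rho c.tdel = c.shi - c.slo := by
  simp only [checkNodes, Bool.and_eq_true, decide_eq_true_eq] at h; exact h.2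

/-- `0 < z̄_k`. [folklore] -/
theorem zb_pos (h : c.checkNode k = true) : 0 < c.zb k := by
  simp only [checkNode, Bool.and_eq_true, decide_eq_true_eq] at h; exact h.1.1.1.1
/-- `z̄_k ≤ z_k`. [folklore] -/
theorem zb_le_z (h : c.checkNode k = true) : c.zb k ≤ c.z k := by
  simp only [checkNode, Bool.and_eq_true, decide_eq_true_eq] at h; exact h.1.1.1.2
/-- `z_k < 1`. [folklore] -/
theorem z_lt_one (h : c.checkNode k = true) : c.z k < 1 := by
  simp only [checkNode, Bool.and_eq_true, decide_eq_true_eq] at h; exact h.1.1.2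
/-- `0 < z_k`. [folklore] -/
theorem z_pos (h : c.checkNode k = true) : 0 < c.z k := lt_of_lt_of_le (zb_pos h) (zb_le_z h)
/-- `z̄_k < 1`. [folklore] -/
theorem zb_lt_one (h : c.checkNode k = true) : c.zb k < 1 := lt_of_le_of_lt (zb_le_z h) (z_lt_one h)
/-- `0 < u_k`. [folklore] -/
theorem u_pos (h : c.checkNode k = true) : 0 < c.u k := mul_pos (z_pos h) (zb_pos h)
/-- `0 < v_k`. [folklore] -/
theorem v_pos (h : c.checkNode k = true) : 0 < c.v k :=
  mul_pos (by linarith [z_lt_one h]) (by linarith [zb_lt_one h])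

/-- the `u`-atoms of a node are checked roots. [folklore] -/
theorem atomsU_ok (h : c.checkNode k = true) :
    checkAtoms c.S (c.u k).num.toNat (c.u k).den c.rho (c.atomsU.getD k []) = true := by
  simp only [checkNode, Bool.and_eq_true, decide_eq_true_eq] at h; exact h.1.2
/-- the `v`-atoms of a node are checked roots. [folklore] -/
theorem atomsV_ok (h : c.checkNode k = true) :
    checkAtoms c.S (c.v k).num.toNat (c.v k).den c.rho (c.atomsV.getD k []) = true := by
  simp only [checkNode, Bool.and_eq_true, decide_eq_true_eq] at h; exact h.2

/-- a positive rational as `num.toNat / den` in `ℝ` [folklore] -/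
theorem cast_eq_toNat_div {x : ℚ} (hx : 0 < x) : ((x.num.toNat : ℕ) : ℝ) / (x.den : ℝ) = (x : ℝ) := by
  have hn : ((x.num.toNat : ℕ) : ℤ) = x.num := Int.toNat_of_nonneg (Rat.num_nonneg.mpr hx.le)
  rw [Rat.cast_def x, ← hn]
  push_cast
  rfl

/-- positivity of a numerator as a natural. [folklore] -/
theorem num_toNat_pos {x : ℚ} (hx : 0 < x) : 0 < x.num.toNat := by
  have := Rat.num_pos.mpr hx; omega

/-- **Powers of `u_k`.** [folklore] -/
theorem mem_powU (h : c.checkNode k = true) (hS : 0 < c.S) (r : PowReq) (hr : r.ok = true) :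
    MI.mem c.S (((c.u k : ℚ) : ℝ) ^ ((r.expo c.rho : ℚ) : ℝ)) (c.powU k r) := by
  have := mem_evalPow hS (num_toNat_pos (u_pos h)) (c.u k).den_pos (atomsU_ok h) r hr
  rwa [cast_eq_toNat_div (u_pos h)] at this

/-- **Powers of `v_k`.** [folklore] -/
theorem mem_powV (h : c.checkNode k = true) (hS : 0 < c.S) (r : PowReq) (hr : r.ok = true) :
    MI.mem c.S (((c.v k : ℚ) : ℝ) ^ ((r.expo c.rho : ℚ) : ℝ)) (c.powV k r) := by
  have := mem_evalPow hS (num_toNat_pos (v_pos h)) (c.v k).den_pos (atomsV_ok h) r hr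
  rwa [cast_eq_toNat_div (v_pos h)] at this

/-- atoms of `u_k` directly. [folklore] -/
theorem mem_atomU (h : c.checkNode k = true) (hS : 0 < c.S) (t : ℕ) :
    MI.mem c.S (((c.u k : ℚ) : ℝ) ^ ((atomExp c.rho t : ℚ) : ℝ)) (atomMI c.S (c.atomsU.getD k []) t) := by
  have := mem_atomMI hS (num_toNat_pos (u_pos h)) (c.u k).den_pos _ _ (atomsU_ok h) t
  rwa [cast_eq_toNat_div (u_pos h)] at this

/-- atoms of `v_k` directly. [folklore] -/
theorem mem_atomV (h : c.checkNode k = true) (hS : 0 < c.S) (t : ℕ) :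
    MI.mem c.S (((c.v k : ℚ) : ℝ) ^ ((atomExp c.rho t : ℚ) : ℝ)) (atomMI c.S (c.atomsV.getD k []) t) := by
  have := mem_atomMI hS (num_toNat_pos (v_pos h)) (c.v k).den_pos _ _ (atomsV_ok h) t
  rwa [cast_eq_toNat_div (v_pos h)] at this

end NodeFacts

/-! ### Node constants and the two-corner differences -/

/-- the four node constants `(w⁺ v^shi, w⁻ v^slo, w⁻ u^shi, w⁺ u^slo)` [folklore] -/
structure NC4 where
  apl : MI
  ami : MI
  bpl : MI
  bmi : MI

/-- node constants of node `k` [folklore] -/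
def nc4 (k : ℕ) : NC4 :=
  ⟨mulQ (c.powV k c.rShi) (c.wp k), mulQ (c.powV k c.rSlo) (c.wm k),
   mulQ (c.powU k c.rShi) (c.wm k), mulQ (c.powU k c.rSlo) (c.wp k)⟩

/-- the table of node constants [folklore] -/
def ncTab : List NC4 := vtab c.N c.nc4

/-- `D = apl·X₂ − ami·X₁ ∋ w⁺ v^shi x₂ − w⁻ v^slo x₁` [folklore] -/
def DU (S : ℕ) (n : NC4) (X1 X2 : MI) : MI := MI.sub (MI.mul S n.apl X2) (MI.mul S n.ami X1)
/-- `D̃ = bpl·Y₂ − bmi·Y₁ ∋ w⁻ u^shi y₂ − w⁺ u^slo y₁` [folklore] -/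
def DV (S : ℕ) (n : NC4) (Y1 Y2 : MI) : MI := MI.sub (MI.mul S n.bpl Y2) (MI.mul S n.bmi Y1)

section DFacts
variable {c} {k : ℕ}

/-- the real meaning of the node constants [folklore] -/
theorem mem_nc4 (hc : c.checkNodes = true) (hk : k < c.N) :
    MI.mem c.S (((c.wp k : ℚ) : ℝ) * ((c.v k : ℚ) : ℝ) ^ ((c.shi : ℚ) : ℝ)) (c.nc4 k).apl ∧
    MI.mem c.S (((c.wm k : ℚ) : ℝ) * ((c.v k : ℚ) : ℝ) ^ ((c.slo : ℚ) : ℝ)) (c.nc4 k).ami ∧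
    MI.mem c.S (((c.wm k : ℚ) : ℝ) * ((c.u k : ℚ) : ℝ) ^ ((c.shi : ℚ) : ℝ)) (c.nc4 k).bpl ∧
    MI.mem c.S (((c.wp k : ℚ) : ℝ) * ((c.u k : ℚ) : ℝ) ^ ((c.slo : ℚ) : ℝ)) (c.nc4 k).bmi := by
  have hS := S_pos hc
  have hn := checkNode_of_checkNodes hc hk
  have eslo : (c.rSlo.expo c.rho) = c.slo := by simp [PowReq.expo, rSlo, tslo_eq hc]
  have eshi : (c.rShi.expo c.rho) = c.shi := by simp [PowReq.expo, rShi, tshi_eq hc]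
  have ok1 : c.rSlo.ok = true := by simp [PowReq.ok, rSlo]
  have ok2 : c.rShi.ok = true := by simp [PowReq.ok, rShi]
  refine ⟨?_, ?_, ?_, ?_⟩
  · have := mem_mulQ (mem_powV hn hS c.rShi ok2) (c.wp k); rw [eshi] at this
    simpa [nc4, mul_comm] using this
  · have := mem_mulQ (mem_powV hn hS c.rSlo ok1) (c.wm k); rw [eslo] at this
    simpa [nc4, mul_comm] using this
  · have := mem_mulQ (mem_powU hn hS c.rShi ok2) (c.wm k); rw [eshi] at this
    simpa [nc4, mul_comm] using this
  · have := mem_mulQ (mem_powU hn hS c.rSlo ok1) (c.wp k); rw [eslo] at this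
    simpa [nc4, mul_comm] using this

/-- interval soundness of `DU`. [folklore] -/
theorem mem_DU {S : ℕ} (hS : 0 < S) {n : NC4} {ap am x1 x2 : ℝ} {X1 X2 : MI}
    (hap : MI.mem S ap n.apl) (ham : MI.mem S am n.ami) (h1 : MI.mem S x1 X1) (h2 : MI.mem S x2 X2) :
    MI.mem S (ap * x2 - am * x1) (DU S n X1 X2) :=
  MI.mem_sub (MI.mem_mul hS hap h2) (MI.mem_mul hS ham h1)

/-- interval soundness of `DV`. [folklore] -/
theorem mem_DV {S : ℕ} (hS : 0 < S) {n : NC4} {bp bm y1 y2 : ℝ} {Y1 Y2 : MI}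
    (hbp : MI.mem S bp n.bpl) (hbm : MI.mem S bm n.bmi) (h1 : MI.mem S y1 Y1) (h2 : MI.mem S y2 Y2) :
    MI.mem S (bp * y2 - bm * y1) (DV S n Y1 Y2) :=
  MI.mem_sub (MI.mem_mul hS hbp h2) (MI.mem_mul hS hbm h1)

end DFacts

/-! ### The box sum `Σ_k ⌊P_k D_k⌋ + ⌊P̃_k D̃_k⌋` -/

/-- lower bound (scaled by `S`) of `Σ_k P_k d_k + P̃_k d̃_k` from the node tables, consumed head first:
node constants, coefficients `P`, `P̃`, and the four power intervals per node. [folklore] -/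
def boxLoAux (S : ℕ) : List NC4 → List ℚ → List ℚ → List MI → List MI → List MI → List MI → ℤ
  | n :: nc, p :: P, pt :: Pt, x1 :: X1, x2 :: X2, y1 :: Y1, y2 :: Y2 =>
    floorMul p (DU S n x1 x2).lo + floorMul pt (DV S n y1 y2).lo + boxLoAux S nc P Pt X1 X2 Y1 Y2
  | _, _, _, _, _, _, _ => 0

/-- **Soundness of the box sum**: with all lists of length `N` and entrywise enclosures, the integer
is `≤ S · Σ_{k<N} (P_k (ap_k x2_k − am_k x1_k) + P̃_k (bp_k y2_k − bm_k y1_k))`. [folklore] -/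
theorem boxLoAux_le {S : ℕ} (hS : 0 < S) (ap am bp bm x1 x2 y1 y2 : ℕ → ℝ) :
    ∀ (nc : List NC4) (P Pt : List ℚ) (X1 X2 Y1 Y2 : List MI),
      P.length = nc.length → Pt.length = nc.length → X1.length = nc.length → X2.length = nc.length →
      Y1.length = nc.length → Y2.length = nc.length →
      (∀ k < nc.length, MI.mem S (ap k) (nc.getD k ⟨⟨0,0⟩,⟨0,0⟩,⟨0,0⟩,⟨0,0⟩⟩).apl ∧
        MI.mem S (am k) (nc.getD k ⟨⟨0,0⟩,⟨0,0⟩,⟨0,0⟩,⟨0,0⟩⟩).ami ∧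
        MI.mem S (bp k) (nc.getD k ⟨⟨0,0⟩,⟨0,0⟩,⟨0,0⟩,⟨0,0⟩⟩).bpl ∧
        MI.mem S (bm k) (nc.getD k ⟨⟨0,0⟩,⟨0,0⟩,⟨0,0⟩,⟨0,0⟩⟩).bmi) →
      (∀ k < nc.length, 0 ≤ vget P k) → (∀ k < nc.length, 0 ≤ vget Pt k) →
      (∀ k < nc.length, MI.mem S (x1 k) (miAt X1 k)) → (∀ k < nc.length, MI.mem S (x2 k) (miAt X2 k)) →
      (∀ k < nc.length, MI.mem S (y1 k) (miAt Y1 k)) → (∀ k < nc.length, MI.mem S (y2 k) (miAt Y2 k)) →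
      (boxLoAux S nc P Pt X1 X2 Y1 Y2 : ℝ) ≤
        S * ∑ k ∈ Finset.range nc.length, (((vget P k : ℚ) : ℝ) * (ap k * x2 k - am k * x1 k) +
          ((vget Pt k : ℚ) : ℝ) * (bp k * y2 k - bm k * y1 k))
  | [], [], [], [], [], [], [], _, _, _, _, _, _, _, _, _, _, _, _, _ => by simp [boxLoAux]
  | n :: nc, p :: P, pt :: Pt, X1h :: X1, X2h :: X2, Y1h :: Y1, Y2h :: Y2,
      hP, hPt, hX1, hX2, hY1, hY2, hnc, hp, hpt, hx1, hx2, hy1, hy2 => by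
    simp only [List.length_cons, Nat.add_right_cancel_iff] at hP hPt hX1 hX2 hY1 hY2
    rw [boxLoAux, List.length_cons, Finset.sum_range_succ']
    push_cast
    -- head terms
    have h0 := hnc 0 (by simp)
    simp only [List.getD_cons_zero] at h0
    have hp0 : 0 ≤ p := by simpa [vget] using hp 0 (by simp)
    have hpt0 : 0 ≤ pt := by simpa [vget] using hpt 0 (by simp)
    have hx10 : MI.mem S (x1 0) X1h := by simpa [miAt] using hx1 0 (by simp)
    have hx20 : MI.mem S (x2 0) X2h := by simpa [miAt] using hx2 0 (by simp)
    have hy10 : MI.mem S (y1 0) Y1h := by simpa [miAt] using hy1 0 (by simp)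
    have hy20 : MI.mem S (y2 0) Y2h := by simpa [miAt] using hy2 0 (by simp)
    have hd := (mem_DU hS h0.1 h0.2.1 hx10 hx20).1
    have hdt := (mem_DV hS h0.2.2.1 h0.2.2.2 hy10 hy20).1
    have t1 := floorMul_le hp0 hd
    have t2 := floorMul_le hpt0 hdt
    -- tail
    have ih := boxLoAux_le hS (fun k => ap (k+1)) (fun k => am (k+1)) (fun k => bp (k+1))
      (fun k => bm (k+1)) (fun k => x1 (k+1)) (fun k => x2 (k+1)) (fun k => y1 (k+1)) (fun k => y2 (k+1))
      nc P Pt X1 X2 Y1 Y2 hP hPt hX1 hX2 hY1 hY2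
      (fun k hk => by simpa using hnc (k+1) (by simpa using hk))
      (fun k hk => by simpa [vget] using hp (k+1) (by simpa using hk))
      (fun k hk => by simpa [vget] using hpt (k+1) (by simpa using hk))
      (fun k hk => by simpa [miAt] using hx1 (k+1) (by simpa using hk))
      (fun k hk => by simpa [miAt] using hx2 (k+1) (by simpa using hk))
      (fun k hk => by simpa [miAt] using hy1 (k+1) (by simpa using hk))
      (fun k hk => by simpa [miAt] using hy2 (k+1) (by simpa using hk))
    simp only [vget, List.getD_cons_zero, List.getD_cons_succ] at ih ⊢
    have hSR : (0 : ℝ) < S := by exact_mod_cast hS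
    nlinarith [t1, t2, ih]
  | [], _ :: _, _, _, _, _, _, h, _, _, _, _, _, _, _, _, _, _, _, _ => by simp at h
  | [], _, _ :: _, _, _, _, _, _, h, _, _, _, _, _, _, _, _, _, _, _ => by simp at h
  | [], _, _, _ :: _, _, _, _, _, _, h, _, _, _, _, _, _, _, _, _, _ => by simp at h
  | [], _, _, _, _ :: _, _, _, _, _, _, h, _, _, _, _, _, _, _, _, _ => by simp at h
  | [], _, _, _, _, _ :: _, _, _, _, _, _, h, _, _, _, _, _, _, _, _ => by simp at h
  | [], _, _, _, _, _, _ :: _, _, _, _, _, _, h, _, _, _, _, _, _, _ => by simp at h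
  | _ :: _, [], _, _, _, _, _, h, _, _, _, _, _, _, _, _, _, _, _, _ => by simp at h
  | _ :: _, _, [], _, _, _, _, _, h, _, _, _, _, _, _, _, _, _, _, _ => by simp at h
  | _ :: _, _, _, [], _, _, _, _, _, h, _, _, _, _, _, _, _, _, _, _ => by simp at h
  | _ :: _, _, _, _, [], _, _, _, _, _, h, _, _, _, _, _, _, _, _, _ => by simp at h
  | _ :: _, _, _, _, _, [], _, _, _, _, _, h, _, _, _, _, _, _, _, _ => by simp at h
  | _ :: _, _, _, _, _, _, [], _, _, _, _, _, h, _, _, _, _, _, _, _ => by simp at h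

end PCert

end PointKernel

end Literature.MathematicalPhysics.QuantumFieldTheory.ConformalBootstrap3D

namespace Literature.MathematicalPhysics.QuantumFieldTheory.ConformalBootstrap3D

namespace PointKernel

open Literature.Analysis.ValidatedNumerics (rsum rall vget vtab vget_vtab vget_of_length_le rsum_eq_sum
  rall_eq_true_iff of_rall)
open Literature.Analysis.ValidatedNumerics.NumericsMP
open Real Finset

/-! ### Nonnegativity of the Legendre forms over `ℚ` -/

/-- `λ_n ≥ 0`. [folklore] -/
theorem legendreLamQ_nonneg : ∀ i : ℕ, 0 ≤ legendreLamQ i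
  | 0 => by simp [legendreLamQ]
  | i + 1 => by
    rw [legendreLamQ]
    exact div_nonneg (mul_nonneg (legendreLamQ_nonneg i) (by positivity)) (by positivity)

/-- `𝒫_j(x,y) ≥ 0` for `x, y ≥ 0`. [folklore] -/
theorem zLegendreQ_nonneg (j : ℕ) {x y : ℚ} (hx : 0 ≤ x) (hy : 0 ≤ y) : 0 ≤ zLegendreQ j x y := by
  unfold zLegendreQ
  exact sum_nonneg fun c _ => mul_nonneg (mul_nonneg (mul_nonneg (legendreLamQ_nonneg _)
    (legendreLamQ_nonneg _)) (pow_nonneg hx _)) (pow_nonneg hy _)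

/-- `getD` of a tabulated list. [folklore] -/
theorem getD_vtab {α : Type*} (n : ℕ) (f : ℕ → α) (d : α) {k : ℕ} (hk : k < n) :
    (vtab n f).getD k d = f k := by
  unfold vtab
  rw [List.getD_eq_getElem?_getD, List.getElem?_map, List.getElem?_range hk]
  rfl

/-- `getD` of a `zipWith`. [folklore] -/
theorem getD_zipWith {α β γ : Type*} (f : α → β → γ) :
    ∀ (l : List α) (l' : List β) (k : ℕ) (da : α) (db : β) (dc : γ),
      k < l.length → k < l'.length → (List.zipWith f l l').getD k dc = f (l.getD k da) (l'.getD k db)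
  | [], _, k, _, _, _, h, _ => by simp at h
  | _ :: _, [], k, _, _, _, _, h => by simp at h
  | a :: l, b :: l', 0, _, _, _, _, _ => by simp
  | a :: l, b :: l', k + 1, da, db, dc, h, h' => by
    simp only [List.zipWith_cons_cons, List.getD_cons_succ]
    exact getD_zipWith f l l' k da db dc (by simpa using h) (by simpa using h')

namespace PCert

variable (c : PCert)

/-! ### The corner bound as a range sum, and the core box lemma -/

/-- `termCornerBound` of the certificate's functional written as a sum over `range N`. [folklore] -/
noncomputable def tcbN (j : ℕ) (E₁ E₂ : ℝ) : ℝ :=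
  ∑ k ∈ range c.N,
    ((max ((c.w k : ℚ) : ℝ) 0 * (((1 - ((c.z k : ℚ) : ℝ)) * (1 - ((c.zb k : ℚ) : ℝ))) ^ ((c.shi : ℚ) : ℝ) *
        zMono E₂ j ((c.z k : ℚ) : ℝ) ((c.zb k : ℚ) : ℝ))
      - max (-((c.w k : ℚ) : ℝ)) 0 * (((1 - ((c.z k : ℚ) : ℝ)) * (1 - ((c.zb k : ℚ) : ℝ))) ^ ((c.slo : ℚ) : ℝ) *
        zMono E₁ j ((c.z k : ℚ) : ℝ) ((c.zb k : ℚ) : ℝ)))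
    + (max (-((c.w k : ℚ) : ℝ)) 0 * ((((c.z k : ℚ) : ℝ) * ((c.zb k : ℚ) : ℝ)) ^ ((c.shi : ℚ) : ℝ) *
        zMono E₂ j (1 - ((c.z k : ℚ) : ℝ)) (1 - ((c.zb k : ℚ) : ℝ)))
      - max ((c.w k : ℚ) : ℝ) 0 * ((((c.z k : ℚ) : ℝ) * ((c.zb k : ℚ) : ℝ)) ^ ((c.slo : ℚ) : ℝ) *
        zMono E₁ j (1 - ((c.z k : ℚ) : ℝ)) (1 - ((c.zb k : ℚ) : ℝ)))))

/-- the corner bound as a range sum over the nodes. [folklore] -/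
theorem termCornerBound_eq_tcbN (j : ℕ) (E₁ E₂ : ℝ) :
    termCornerBound c.wR c.zR c.zbR j E₁ E₂ ((c.slo : ℚ) : ℝ) ((c.shi : ℚ) : ℝ) = c.tcbN j E₁ E₂ := by
  unfold tcbN termCornerBound
  rw [Finset.sum_range]
  rfl

variable {c}

/-- **Core box lemma.** With coefficient lists `P_k = 𝒫_j(z_k, z̄_k)`, `P̃_k = 𝒫_j(1-z_k, 1-z̄_k)` and
intervals enclosing `u_k^{e₁}, u_k^{e₂}, v_k^{e₁}, v_k^{e₂}`, the box sum is `≤ S ·` the corner bound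
of the box `[2e₁ + j, 2e₂ + j]`. [folklore] -/
theorem boxLoAux_le_tcb (hc : c.checkNodes = true) (j : ℕ) (P Pt : List ℚ)
    (hPl : P.length = c.N) (hPtl : Pt.length = c.N)
    (hP : ∀ k < c.N, vget P k = zLegendreQ j (c.z k) (c.zb k))
    (hPt : ∀ k < c.N, vget Pt k = zLegendreQ j (1 - c.z k) (1 - c.zb k))
    (e₁ e₂ : ℚ) (X1 X2 Y1 Y2 : List MI) (hX1l : X1.length = c.N) (hX2l : X2.length = c.N)
    (hY1l : Y1.length = c.N) (hY2l : Y2.length = c.N)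
    (hX1 : ∀ k < c.N, MI.mem c.S (((c.u k : ℚ) : ℝ) ^ ((e₁ : ℚ) : ℝ)) (miAt X1 k))
    (hX2 : ∀ k < c.N, MI.mem c.S (((c.u k : ℚ) : ℝ) ^ ((e₂ : ℚ) : ℝ)) (miAt X2 k))
    (hY1 : ∀ k < c.N, MI.mem c.S (((c.v k : ℚ) : ℝ) ^ ((e₁ : ℚ) : ℝ)) (miAt Y1 k))
    (hY2 : ∀ k < c.N, MI.mem c.S (((c.v k : ℚ) : ℝ) ^ ((e₂ : ℚ) : ℝ)) (miAt Y2 k)) :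
    (boxLoAux c.S c.ncTab P Pt X1 X2 Y1 Y2 : ℝ) ≤
      c.S * termCornerBound c.wR c.zR c.zbR j (((2 * e₁ + j : ℚ) : ℝ)) (((2 * e₂ + j : ℚ) : ℝ))
        ((c.slo : ℚ) : ℝ) ((c.shi : ℚ) : ℝ) := by
  have hS := S_pos hc
  have hncl : c.ncTab.length = c.N := by simp [ncTab, vtab]
  have key := boxLoAux_le hS
    (fun k => ((c.wp k : ℚ) : ℝ) * ((c.v k : ℚ) : ℝ) ^ ((c.shi : ℚ) : ℝ))
    (fun k => ((c.wm k : ℚ) : ℝ) * ((c.v k : ℚ) : ℝ) ^ ((c.slo : ℚ) : ℝ))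
    (fun k => ((c.wm k : ℚ) : ℝ) * ((c.u k : ℚ) : ℝ) ^ ((c.shi : ℚ) : ℝ))
    (fun k => ((c.wp k : ℚ) : ℝ) * ((c.u k : ℚ) : ℝ) ^ ((c.slo : ℚ) : ℝ))
    (fun k => ((c.u k : ℚ) : ℝ) ^ ((e₁ : ℚ) : ℝ)) (fun k => ((c.u k : ℚ) : ℝ) ^ ((e₂ : ℚ) : ℝ))
    (fun k => ((c.v k : ℚ) : ℝ) ^ ((e₁ : ℚ) : ℝ)) (fun k => ((c.v k : ℚ) : ℝ) ^ ((e₂ : ℚ) : ℝ))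
    c.ncTab P Pt X1 X2 Y1 Y2 (by rw [hPl, hncl]) (by rw [hPtl, hncl]) (by rw [hX1l, hncl])
    (by rw [hX2l, hncl]) (by rw [hY1l, hncl]) (by rw [hY2l, hncl])
    (fun k hk => by
      rw [hncl] at hk
      simp only [ncTab, getD_vtab _ _ _ hk]
      exact mem_nc4 hc hk)
    (fun k hk => by
      rw [hncl] at hk; rw [hP k hk]
      have hn := checkNode_of_checkNodes hc hk
      exact zLegendreQ_nonneg j (z_pos hn).le (zb_pos hn).le)
    (fun k hk => by
      rw [hncl] at hk; rw [hPt k hk]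
      have hn := checkNode_of_checkNodes hc hk
      exact zLegendreQ_nonneg j (by linarith [z_lt_one hn]) (by linarith [zb_lt_one hn]))
    (fun k hk => hX1 k (hncl ▸ hk)) (fun k hk => hX2 k (hncl ▸ hk))
    (fun k hk => hY1 k (hncl ▸ hk)) (fun k hk => hY2 k (hncl ▸ hk))
  rw [hncl] at key
  refine key.trans (le_of_eq ?_)
  congr 1
  rw [termCornerBound_eq_tcbN, tcbN]
  refine sum_congr rfl fun k hk => ?_
  rw [mem_range] at hk
  have hn := checkNode_of_checkNodes hc hk
  rw [hP k hk, hPt k hk, cast_zLegendreQ, cast_zLegendreQ]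
  have ex1 : ((((2 * e₁ + j : ℚ) : ℝ)) - (j : ℕ)) / 2 = ((e₁ : ℚ) : ℝ) := by push_cast; ring
  have ex2 : ((((2 * e₂ + j : ℚ) : ℝ)) - (j : ℕ)) / 2 = ((e₂ : ℚ) : ℝ) := by push_cast; ring
  simp only [zMono, ex1, ex2]
  have hu : ((c.u k : ℚ) : ℝ) = ((c.z k : ℚ) : ℝ) * ((c.zb k : ℚ) : ℝ) := by simp [PCert.u]
  have hv : ((c.v k : ℚ) : ℝ) = (1 - ((c.z k : ℚ) : ℝ)) * (1 - ((c.zb k : ℚ) : ℝ)) := by simp [PCert.v]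
  have hwp : ((c.wp k : ℚ) : ℝ) = max ((c.w k : ℚ) : ℝ) 0 := by simp [PCert.wp]
  have hwm : ((c.wm k : ℚ) : ℝ) = max (-((c.w k : ℚ) : ℝ)) 0 := by simp [PCert.wm]
  rw [hu, hv, hwp, hwm]
  push_cast
  ring

/-! ### Rows of (M) boxes: chains of powers -/

/-- one box step for all nodes: multiply node `k`'s interval by its atom `t`. [folklore] -/
def stepAll (S : ℕ) (A : List (List MI)) (t : ℕ) (X : List MI) : List MI :=
  List.zipWith (fun x a => MI.mul S x (atomMI S a t)) X A

/-- the exponents along a row: `e, e + ρ_{t₀}, e + ρ_{t₀} + ρ_{t₁}, …`. [folklore] -/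
def exList (rho : List (ℕ × ℕ)) : List ℕ → ℚ → List ℚ
  | [], e => [e]
  | t :: steps, e => e :: exList rho steps (e + atomExp rho t)

/-- entry lemma for `exList`. [folklore] -/
theorem vget_exList_zero (rho : List (ℕ × ℕ)) : ∀ (steps : List ℕ) (e : ℚ),
    vget (exList rho steps e) 0 = e
  | [], e => by simp [exList, vget]
  | _ :: _, e => by simp [exList, vget]

/-- check every box of a row: structural on the list of box steps. [folklore] -/
def rowOK (S : ℕ) (nc : List NC4) (P Pt : List ℚ) (AU AV : List (List MI)) :
    List ℕ → List MI → List MI → Bool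
  | [], _, _ => true
  | t :: steps, X, Y =>
    let X' := stepAll S AU t X
    let Y' := stepAll S AV t Y
    decide (0 ≤ boxLoAux S nc P Pt X X' Y Y') && rowOK S nc P Pt AU AV steps X' Y'

/-- `stepAll` preserves the length. [folklore] -/
theorem length_stepAll (S : ℕ) (A : List (List MI)) (t : ℕ) (X : List MI) (h : A.length = X.length) :
    (stepAll S A t X).length = X.length := by
  simp [stepAll, List.length_zipWith, h]

/-- the chain step is sound. [folklore] -/
theorem mem_stepAll_U (hc : c.checkNodes = true) (hAl : c.atomsU.length = c.N) (t : ℕ) (e : ℚ)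
    (X : List MI) (hXl : X.length = c.N)
    (hX : ∀ k < c.N, MI.mem c.S (((c.u k : ℚ) : ℝ) ^ ((e : ℚ) : ℝ)) (miAt X k)) :
    ∀ k < c.N, MI.mem c.S (((c.u k : ℚ) : ℝ) ^ (((e + atomExp c.rho t : ℚ) : ℚ) : ℝ))
      (miAt (stepAll c.S c.atomsU t X) k) := by
  intro k hk
  have hS := S_pos hc
  have hn := checkNode_of_checkNodes hc hk
  unfold miAt stepAll
  rw [getD_zipWith (fun x a => MI.mul c.S x (atomMI c.S a t)) X c.atomsU k ⟨0, 0⟩ [] ⟨0, 0⟩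
    (by omega) (by omega)]
  have h1 := hX k hk
  have h2 := mem_atomU hn hS t
  have := MI.mem_mul hS h1 h2
  convert this using 2
  · have hu : (0 : ℝ) < ((c.u k : ℚ) : ℝ) := by exact_mod_cast u_pos hn
    push_cast
    rw [Real.rpow_add hu]
  · rfl

/-- interval soundness of `stepAll` (reflected). [folklore] -/
theorem mem_stepAll_V (hc : c.checkNodes = true) (hAl : c.atomsV.length = c.N) (t : ℕ) (e : ℚ)
    (Y : List MI) (hYl : Y.length = c.N)
    (hY : ∀ k < c.N, MI.mem c.S (((c.v k : ℚ) : ℝ) ^ ((e : ℚ) : ℝ)) (miAt Y k)) :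
    ∀ k < c.N, MI.mem c.S (((c.v k : ℚ) : ℝ) ^ (((e + atomExp c.rho t : ℚ) : ℚ) : ℝ))
      (miAt (stepAll c.S c.atomsV t Y) k) := by
  intro k hk
  have hS := S_pos hc
  have hn := checkNode_of_checkNodes hc hk
  unfold miAt stepAll
  rw [getD_zipWith (fun x a => MI.mul c.S x (atomMI c.S a t)) Y c.atomsV k ⟨0, 0⟩ [] ⟨0, 0⟩
    (by omega) (by omega)]
  have h1 := hY k hk
  have h2 := mem_atomV hn hS t
  have := MI.mem_mul hS h1 h2
  convert this using 2
  · have hv : (0 : ℝ) < ((c.v k : ℚ) : ℝ) := by exact_mod_cast v_pos hn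
    push_cast
    rw [Real.rpow_add hv]
  · rfl

/-- **Soundness of a row of boxes.** [folklore] -/
theorem rowOK_sound (hc : c.checkNodes = true) (hAU : c.atomsU.length = c.N)
    (hAV : c.atomsV.length = c.N) (j : ℕ) (P Pt : List ℚ)
    (hPl : P.length = c.N) (hPtl : Pt.length = c.N)
    (hP : ∀ k < c.N, vget P k = zLegendreQ j (c.z k) (c.zb k))
    (hPt : ∀ k < c.N, vget Pt k = zLegendreQ j (1 - c.z k) (1 - c.zb k)) :
    ∀ (steps : List ℕ) (e : ℚ) (X Y : List MI), X.length = c.N → Y.length = c.N →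
      (∀ k < c.N, MI.mem c.S (((c.u k : ℚ) : ℝ) ^ ((e : ℚ) : ℝ)) (miAt X k)) →
      (∀ k < c.N, MI.mem c.S (((c.v k : ℚ) : ℝ) ^ ((e : ℚ) : ℝ)) (miAt Y k)) →
      rowOK c.S c.ncTab P Pt c.atomsU c.atomsV steps X Y = true →
      ∀ m < steps.length, 0 ≤ termCornerBound c.wR c.zR c.zbR j
        (((2 * vget (exList c.rho steps e) m + j : ℚ) : ℝ))
        (((2 * vget (exList c.rho steps e) (m + 1) + j : ℚ) : ℝ)) ((c.slo : ℚ) : ℝ) ((c.shi : ℚ) : ℝ)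
  | [], _, _, _, _, _, _, _, _, m, hm => by simp at hm
  | t :: steps, e, X, Y, hXl, hYl, hX, hY, h, m, hm => by
    simp only [rowOK, Bool.and_eq_true, decide_eq_true_eq] at h
    obtain ⟨hbox, hrest⟩ := h
    have hX' := mem_stepAll_U hc hAU t e X hXl hX
    have hY' := mem_stepAll_V hc hAV t e Y hYl hY
    have hXl' : (stepAll c.S c.atomsU t X).length = c.N := by
      rw [length_stepAll _ _ _ _ (by omega), hXl]
    have hYl' : (stepAll c.S c.atomsV t Y).length = c.N := by
      rw [length_stepAll _ _ _ _ (by omega), hYl]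
    cases m with
    | zero =>
      have e0 : vget (exList c.rho (t :: steps) e) 0 = e := vget_exList_zero _ _ _
      have e1 : vget (exList c.rho (t :: steps) e) (0 + 1) = e + atomExp c.rho t := by
        simp only [exList, vget, List.getD_cons_succ, zero_add]
        exact vget_exList_zero c.rho steps _
      rw [e0, e1]
      have key := boxLoAux_le_tcb hc j P Pt hPl hPtl hP hPt e (e + atomExp c.rho t) X _ Y _ hXl hXl'
        hYl hYl' hX hX' hY hY'
      have hS : (0 : ℝ) < c.S := by exact_mod_cast S_pos hc
      have hb : (0 : ℝ) ≤ (boxLoAux c.S c.ncTab P Pt X (stepAll c.S c.atomsU t X) Y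
        (stepAll c.S c.atomsV t Y) : ℝ) := by exact_mod_cast hbox
      nlinarith
    | succ m =>
      have ih := rowOK_sound hc hAU hAV j P Pt hPl hPtl hP hPt steps (e + atomExp c.rho t) _ _ hXl' hYl'
        hX' hY' hrest m (by simpa using hm)
      simp only [exList, vget, List.getD_cons_succ] at ih ⊢
      exact ih

end PCert

end PointKernel

end Literature.MathematicalPhysics.QuantumFieldTheory.ConformalBootstrap3D

namespace Literature.MathematicalPhysics.QuantumFieldTheory.ConformalBootstrap3D

namespace PointKernel

open Literature.Analysis.ValidatedNumerics (rsum rall vget vtab vget_vtab vget_of_length_le rsum_eq_sum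
  rall_eq_true_iff of_rall)
open Literature.Analysis.ValidatedNumerics.NumericsMP
open Real Finset

/-! ### (M) rows as data, the block checker -/

/-- One (M) row `j`: the request for the first exponent `(E_{j,0} - j)/2` and the atom index
(half-width) of every box. [folklore] -/
structure MRow where
  /-- request for `(E_{j,0} - j)/2` -/
  r0 : PowReq
  /-- box `m` has width `2 ρ_{steps[m]}` -/
  steps : List ℕ

/-- row `j` of a row table (empty junk row beyond). [folklore] -/
def rowAt (rows : List MRow) (j : ℕ) : MRow := rows.getD j ⟨⟨0, 0, 0, 0, 0, 0⟩, []⟩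

/-- entry of a mapped table. [folklore] -/
theorem vget_map_vtab {α β : Type*} [Zero β] (n : ℕ) (g : ℕ → α) (f : α → β) {k : ℕ} (hk : k < n) :
    vget ((vtab n g).map f) k = f (g k) := by
  have : (vtab n g).map f = vtab n (f ∘ g) := by simp [vtab, List.map_map]
  rw [this, vget_vtab _ hk]
  rfl

namespace PCert

variable (c : PCert)

/-- initial power vector `(u_k^{e(r)})_k` [folklore] -/
def X0 (r : PowReq) : List MI := vtab c.N fun k => c.powU k r
/-- initial power vector `(v_k^{e(r)})_k` [folklore] -/
def Y0 (r : PowReq) : List MI := vtab c.N fun k => c.powV k r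
/-- the Legendre rows `𝒫_{0..J}(z_k, z̄_k)` per node [folklore] -/
def legTabs (J : ℕ) : List (List ℚ) := vtab c.N fun k => legTab J (c.z k) (c.zb k)
/-- the Legendre rows `𝒫_{0..J}(1-z_k, 1-z̄_k)` per node [folklore] -/
def legTabsT (J : ℕ) : List (List ℚ) := vtab c.N fun k => legTab J (1 - c.z k) (1 - c.zb k)

/-- **(M) block checker**: rows `jlo ≤ j < jhi`, tables computed once. [folklore] -/
def mBlockOK (rows : List MRow) (jlo jhi : ℕ) : Bool :=
  let nc := c.ncTab
  let LT := c.legTabs (jhi - 1)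
  let LTt := c.legTabsT (jhi - 1)
  decide (c.atomsU.length = c.N) && decide (c.atomsV.length = c.N) &&
  rall (jhi - jlo) fun i =>
    (rowAt rows (jlo + i)).r0.ok &&
      rowOK c.S nc (LT.map fun l => vget l (jlo + i)) (LTt.map fun l => vget l (jlo + i))
        c.atomsU c.atomsV (rowAt rows (jlo + i)).steps
        (c.X0 (rowAt rows (jlo + i)).r0) (c.Y0 (rowAt rows (jlo + i)).r0)

/-- the box end points `E_{j,m}` of the row table (as rationals) [folklore] -/
def eMQ (rows : List MRow) (j m : ℕ) : ℚ :=
  2 * vget (exList c.rho (rowAt rows j).steps ((rowAt rows j).r0.expo c.rho)) m + j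

/-- the box end points as reals [folklore] -/
def eM (rows : List MRow) (j m : ℕ) : ℝ := ((c.eMQ rows j m : ℚ) : ℝ)

variable {c}

/-- **Soundness of an (M) block.** [folklore] -/
theorem mBlockOK_sound (hc : c.checkNodes = true) (rows : List MRow) (jlo jhi : ℕ)
    (h : c.mBlockOK rows jlo jhi = true) :
    ∀ j, jlo ≤ j → j < jhi → ∀ m < (rowAt rows j).steps.length,
      0 ≤ termCornerBound c.wR c.zR c.zbR j (c.eM rows j m) (c.eM rows j (m + 1))
        ((c.slo : ℚ) : ℝ) ((c.shi : ℚ) : ℝ) := by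
  intro j hlo hhi m hm
  simp only [mBlockOK, Bool.and_eq_true, decide_eq_true_eq] at h
  obtain ⟨⟨hAU, hAV⟩, hall⟩ := h
  have hi : j - jlo < jhi - jlo := by omega
  have hrow := of_rall hall hi
  simp only [Bool.and_eq_true, show jlo + (j - jlo) = j by omega] at hrow
  obtain ⟨hok, hrow⟩ := hrow
  have hS := S_pos hc
  have hjJ : j ≤ jhi - 1 := by omega
  have key := rowOK_sound hc hAU hAV j
    ((c.legTabs (jhi - 1)).map fun l => vget l j) ((c.legTabsT (jhi - 1)).map fun l => vget l j)
    (by simp [legTabs, vtab]) (by simp [legTabsT, vtab])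
    (fun k hk => by rw [legTabs, vget_map_vtab _ _ _ hk, vget_legTab hjJ])
    (fun k hk => by rw [legTabsT, vget_map_vtab _ _ _ hk, vget_legTab hjJ])
    (rowAt rows j).steps ((rowAt rows j).r0.expo c.rho) (c.X0 (rowAt rows j).r0) (c.Y0 (rowAt rows j).r0)
    (by simp [X0, vtab]) (by simp [Y0, vtab])
    (fun k hk => by
      simp only [miAt, X0, getD_vtab _ _ _ hk]
      exact mem_powU (checkNode_of_checkNodes hc hk) hS _ hok)
    (fun k hk => by
      simp only [miAt, Y0, getD_vtab _ _ _ hk]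
      exact mem_powV (checkNode_of_checkNodes hc hk) hS _ hok)
    hrow m hm
  simpa [eM, eMQ] using key

/-- meta checks of the (M) rows: start `≤ max(E₀, j + τ)`, end `≥ E_T`, for all `j < J`. [folklore] -/
def mMetaOK (rows : List MRow) (E0 τ : ℚ) (ET J : ℕ) : Bool :=
  rall J fun j => decide (c.eMQ rows j 0 ≤ max E0 ((j : ℚ) + τ)) &&
    decide ((ET : ℚ) ≤ c.eMQ rows j (rowAt rows j).steps.length)

/-- soundness of the (M) meta check. [folklore] -/
theorem mMetaOK_sound (rows : List MRow) (E0 τ : ℚ) (ET J : ℕ) (h : c.mMetaOK rows E0 τ ET J = true) :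
    ∀ j < J, c.eM rows j 0 ≤ max ((E0 : ℚ) : ℝ) ((j : ℝ) + ((τ : ℚ) : ℝ)) ∧
      ((ET : ℕ) : ℝ) ≤ c.eM rows j (rowAt rows j).steps.length := by
  intro j hj
  have := of_rall h hj
  simp only [Bool.and_eq_true, decide_eq_true_eq] at this
  obtain ⟨h1, h2⟩ := this
  refine ⟨?_, ?_⟩
  · have : ((c.eMQ rows j 0 : ℚ) : ℝ) ≤ ((max E0 ((j : ℚ) + τ) : ℚ) : ℝ) := by exact_mod_cast h1
    simpa [eM, Rat.cast_max] using this
  · have : (((ET : ℚ)) : ℝ) ≤ ((c.eMQ rows j (rowAt rows j).steps.length : ℚ) : ℝ) := by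
      exact_mod_cast h2
    simpa [eM] using this

/-- **The (M) hypotheses of the table theorem from block checks.** [folklore] -/
theorem ruleM_hyps (rows : List MRow) (E0 τ : ℚ) (ET J : ℕ)
    (hJ : ((ET : ℕ) : ℝ) ≤ (J : ℝ) + ((τ : ℚ) : ℝ))
    (hmeta : c.mMetaOK rows E0 τ ET J = true)
    (hblocks : ∀ j < J, ∀ m < (rowAt rows j).steps.length,
      0 ≤ termCornerBound c.wR c.zR c.zbR j (c.eM rows j m) (c.eM rows j (m + 1))
        ((c.slo : ℚ) : ℝ) ((c.shi : ℚ) : ℝ)) :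
    (∀ j : ℕ, (j : ℝ) + ((τ : ℚ) : ℝ) < ((ET : ℕ) : ℝ) →
        c.eM rows j 0 ≤ max ((E0 : ℚ) : ℝ) ((j : ℝ) + ((τ : ℚ) : ℝ)) ∧
          ((ET : ℕ) : ℝ) ≤ c.eM rows j (rowAt rows j).steps.length) ∧
    (∀ j m, m < (rowAt rows j).steps.length → (fun (_ _ : ℕ) => false) j m = true →
        ∀ k : Fin c.N, 1 / 2 ≤ (c.zR k * c.zbR k) ^ ((c.eM rows j (m + 1) - c.eM rows j m) / 2) ∧
          1 / 2 ≤ ((1 - c.zR k) * (1 - c.zbR k)) ^ ((c.eM rows j (m + 1) - c.eM rows j m) / 2)) ∧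
    (∀ j : ℕ, (j : ℝ) + ((τ : ℚ) : ℝ) < ((ET : ℕ) : ℝ) → ∀ m < (rowAt rows j).steps.length,
        0 ≤ boxNumber c.wR c.zR c.zbR j (c.eM rows j m) (c.eM rows j (m + 1))
          ((c.slo : ℚ) : ℝ) ((c.shi : ℚ) : ℝ) ((fun (_ _ : ℕ) => false) j m)) := by
  refine ⟨fun j hj => ?_, fun j m _ h => by simp at h, fun j hj m hm => ?_⟩
  · have hjJ : j < J := by
      by_contra hcon
      push Not at hcon
      have : (J : ℝ) ≤ j := by exact_mod_cast hcon
      linarith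
    exact mMetaOK_sound rows E0 τ ET J hmeta j hjJ
  · have hjJ : j < J := by
      by_contra hcon
      push Not at hcon
      have : (J : ℝ) ≤ j := by exact_mod_cast hcon
      linarith
    simpa [boxNumber] using hblocks j hjJ m hm

end PCert

end PointKernel

end Literature.MathematicalPhysics.QuantumFieldTheory.ConformalBootstrap3D

namespace Literature.MathematicalPhysics.QuantumFieldTheory.ConformalBootstrap3D

namespace PointKernel

open Literature.Analysis.ValidatedNumerics (rsum rall vget vtab vget_vtab vget_of_length_le rsum_eq_sum
  rall_eq_true_iff of_rall)
open Literature.Analysis.ValidatedNumerics.NumericsMP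
open Real Finset

/-! ### Half-bounds `1/2 ≤ b^r` (rules (S), (ρ)) -/

/-- `(den b)^a ≤ 2^d (num b)^a` for `r = a/d > 0`, `b > 0`: then `1/2 ≤ b^r`. [folklore] -/
def checkHalf (b r : ℚ) : Bool :=
  decide (0 < r) && decide (0 < b) &&
    decide (((b.den : ℤ)) ^ r.num.toNat ≤ 2 ^ r.den * b.num ^ r.num.toNat)

/-- soundness of `checkHalf`. [folklore] -/
theorem half_le_of_checkHalf {b r : ℚ} (h : checkHalf b r = true) : (1 / 2 : ℝ) ≤ (b : ℝ) ^ (r : ℝ) := by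
  simp only [checkHalf, Bool.and_eq_true, decide_eq_true_eq] at h
  obtain ⟨⟨hr, hb⟩, hle⟩ := h
  have hbR : (0 : ℝ) < b := by exact_mod_cast hb
  set a := r.num.toNat with ha
  have han : (a : ℤ) = r.num := Int.toNat_of_nonneg (Rat.num_nonneg.mpr hr.le)
  have hapos : 0 < a := by have := Rat.num_pos.mpr hr; omega
  have hrR : (r : ℝ) = (a : ℝ) / (r.den : ℝ) := by
    rw [Rat.cast_def r, ← han]; push_cast; rfl
  have hd : r.den ≠ 0 := r.den_pos.ne'
  set t : ℝ := (b : ℝ) ^ (r : ℝ) with ht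
  have ht0 : 0 ≤ t := Real.rpow_nonneg hbR.le _
  have htd : t ^ r.den = (b : ℝ) ^ a := by
    rw [ht, hrR, ← Real.rpow_natCast, ← Real.rpow_mul hbR.le, div_mul_cancel₀ _ (by exact_mod_cast hd),
      Real.rpow_natCast]
  -- (1/2)^den ≤ b^a
  have hbq : (b : ℝ) = (b.num : ℝ) / (b.den : ℝ) := Rat.cast_def b
  have hnum : (0 : ℝ) < b.num := by exact_mod_cast Rat.num_pos.mpr hb
  have hden : (0 : ℝ) < b.den := by exact_mod_cast b.den_pos
  have key : ((1 : ℝ) / 2) ^ r.den ≤ t ^ r.den := by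
    rw [htd, hbq, div_pow, div_pow, one_pow, div_le_div_iff₀ (by positivity) (by positivity), one_mul]
    have : ((b.den : ℤ) : ℝ) ^ a ≤ (2 : ℝ) ^ r.den * ((b.num : ℤ) : ℝ) ^ a := by exact_mod_cast hle
    push_cast at this
    linarith [this]
  exact le_of_pow_le_pow_left₀ hd ht0 key

namespace PCert

variable (c : PCert)

/-! ### Rule (S): `1/2 ≤ v_k^{shi-slo}`, `1/2 ≤ u_k^{shi-slo}` -/

/-- [folklore] -/
def sideOK : Bool := rall c.N fun k => checkHalf (c.v k) (c.shi - c.slo) && checkHalf (c.u k) (c.shi - c.slo)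

variable {c} in
/-- **Rule (S) from the kernel check.** [folklore] -/
theorem side_hyp (h : c.sideOK = true) :
    ∀ k : Fin c.N, 1 / 2 ≤ ((1 - c.zR k) * (1 - c.zbR k)) ^ (((c.shi : ℚ) : ℝ) - ((c.slo : ℚ) : ℝ)) ∧
      1 / 2 ≤ (c.zR k * c.zbR k) ^ (((c.shi : ℚ) : ℝ) - ((c.slo : ℚ) : ℝ)) := by
  intro k
  have := of_rall h k.2
  simp only [Bool.and_eq_true] at this
  obtain ⟨h1, h2⟩ := this
  have e1 := half_le_of_checkHalf h1
  have e2 := half_le_of_checkHalf h2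
  simp only [PCert.v, PCert.u, Rat.cast_sub, Rat.cast_mul, Rat.cast_one] at e1 e2
  exact ⟨e1, e2⟩

/-! ### Rule (O1): `0 < termCornerBound w z zb 0 0 0 slo shi` -/

/-- [folklore] -/
def o1OK : Bool :=
  let ones : List MI := vtab c.N fun _ => MI.ofInt c.S 1
  let P : List ℚ := vtab c.N fun _ => (1 : ℚ)
  decide (0 < boxLoAux c.S c.ncTab P P ones ones ones ones)

variable {c} in
/-- **Rule (O1) from the kernel check.** [folklore] -/
theorem o1_hyp (hc : c.checkNodes = true) (h : c.o1OK = true) :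
    0 < termCornerBound c.wR c.zR c.zbR 0 0 0 ((c.slo : ℚ) : ℝ) ((c.shi : ℚ) : ℝ) := by
  simp only [o1OK, decide_eq_true_eq] at h
  have hS := S_pos hc
  have hone : ∀ (x : ℚ), 0 < x → ∀ k < c.N, MI.mem c.S (((x : ℚ) : ℝ) ^ (((0 : ℚ) : ℚ) : ℝ))
      (miAt (vtab c.N fun _ => MI.ofInt c.S 1) k) := by
    intro x hx k hk
    simp only [miAt, getD_vtab _ _ _ hk, Rat.cast_zero, Real.rpow_zero]
    simpa using MI.mem_ofInt c.S 1
  have key := boxLoAux_le_tcb hc 0 (vtab c.N fun _ => (1 : ℚ)) (vtab c.N fun _ => (1 : ℚ))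
    (by simp [vtab]) (by simp [vtab])
    (fun k hk => by rw [vget_vtab _ hk, zLegendreQ_zero])
    (fun k hk => by rw [vget_vtab _ hk, zLegendreQ_zero]) 0 0 _ _ _ _
    (by simp [vtab]) (by simp [vtab]) (by simp [vtab]) (by simp [vtab])
    (fun k hk => hone _ (u_pos (checkNode_of_checkNodes hc hk)) k hk)
    (fun k hk => hone _ (u_pos (checkNode_of_checkNodes hc hk)) k hk)
    (fun k hk => hone _ (v_pos (checkNode_of_checkNodes hc hk)) k hk)
    (fun k hk => hone _ (v_pos (checkNode_of_checkNodes hc hk)) k hk)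
  have hpos : (0 : ℝ) < (boxLoAux c.S c.ncTab (vtab c.N fun _ => (1 : ℚ)) (vtab c.N fun _ => (1 : ℚ))
      (vtab c.N fun _ => MI.ofInt c.S 1) (vtab c.N fun _ => MI.ofInt c.S 1)
      (vtab c.N fun _ => MI.ofInt c.S 1) (vtab c.N fun _ => MI.ofInt c.S 1) : ℝ) := by exact_mod_cast h
  have hSR : (0 : ℝ) < c.S := by exact_mod_cast hS
  have : (0 : ℝ) < termCornerBound c.wR c.zR c.zbR 0 (((2 * 0 + (0 : ℕ) : ℚ) : ℝ))
      (((2 * 0 + (0 : ℕ) : ℚ) : ℝ)) ((c.slo : ℚ) : ℝ) ((c.shi : ℚ) : ℝ) := by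
    by_contra hcon
    push Not at hcon
    nlinarith
  simpa using this

/-! ### Rule (T): the apex bracket -/

/-- the (T) inequality and the domination data `qd, qr`. [folklore] -/
def tOK (qd qr : List ℚ) (ET : ℕ) : Bool :=
  (rall c.N fun k =>
    decide (0 < vget qd k) && decide (vget qd k ≤ 1) && decide (0 < vget qr k) && decide (vget qr k ≤ 1) &&
    decide (c.u k ≤ vget qd k ^ 2 * c.u c.apex) && decide (c.z k ≤ vget qd k * c.z c.apex) &&
    decide (c.v k ≤ vget qr k ^ 2 * c.u c.apex) && decide (1 - c.zb k ≤ vget qr k * c.z c.apex)) &&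
  decide (
    (rsum c.N fun k => if k = c.apex then (0 : ℤ) else
        (mulQ (c.powV k c.rSlo) (|c.w k| * vget qd k ^ ET)).hi) +
      (rsum c.N fun k => (mulQ (c.powU k c.rSlo) (|c.w k| * vget qr k ^ ET)).hi)
    ≤ (mulQ (c.powV c.apex c.rShi) (c.w c.apex)).lo)

/-- the domination ratios as real vectors [folklore] -/
def qR (q : List ℚ) : Fin c.N → ℝ := fun k => ((vget q k : ℚ) : ℝ)

variable {c} in
/-- **Rule (T) and the domination data from the kernel check.** [folklore] -/
theorem t_hyps (hc : c.checkNodes = true) (qd qr : List ℚ) (ET : ℕ) (h : c.tOK qd qr ET = true) :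
    (∀ k, 0 < c.qR qd k ∧ c.qR qd k ≤ 1) ∧ (∀ k, 0 < c.qR qr k ∧ c.qR qr k ≤ 1) ∧
    (∀ k, c.zR k * c.zbR k ≤ c.qR qd k ^ 2 * (c.zR ⟨c.apex, apex_lt hc⟩ * c.zbR ⟨c.apex, apex_lt hc⟩) ∧
      c.zR k ≤ c.qR qd k * c.zR ⟨c.apex, apex_lt hc⟩) ∧
    (∀ k, (1 - c.zR k) * (1 - c.zbR k) ≤ c.qR qr k ^ 2 * (c.zR ⟨c.apex, apex_lt hc⟩ * c.zbR ⟨c.apex, apex_lt hc⟩) ∧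
      1 - c.zbR k ≤ c.qR qr k * c.zR ⟨c.apex, apex_lt hc⟩) ∧
    (∑ k ∈ univ.erase (⟨c.apex, apex_lt hc⟩ : Fin c.N),
        |c.wR k| * ((1 - c.zR k) * (1 - c.zbR k)) ^ ((c.slo : ℚ) : ℝ) * c.qR qd k ^ ((ET : ℕ) : ℝ)
      + ∑ k, |c.wR k| * (c.zR k * c.zbR k) ^ ((c.slo : ℚ) : ℝ) * c.qR qr k ^ ((ET : ℕ) : ℝ) ≤
      c.wR ⟨c.apex, apex_lt hc⟩ *
        ((1 - c.zR ⟨c.apex, apex_lt hc⟩) * (1 - c.zbR ⟨c.apex, apex_lt hc⟩)) ^ ((c.shi : ℚ) : ℝ)) := by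
  simp only [tOK, Bool.and_eq_true, decide_eq_true_eq] at h
  obtain ⟨hall, hineq⟩ := h
  have hS := S_pos hc
  have hSR : (0 : ℝ) < c.S := by exact_mod_cast hS
  have nodek : ∀ k : Fin c.N, _ := fun k => of_rall hall k.2
  refine ⟨fun k => ?_, fun k => ?_, fun k => ?_, fun k => ?_, ?_⟩
  · have := nodek k; simp only [Bool.and_eq_true, decide_eq_true_eq] at this
    obtain ⟨⟨⟨⟨⟨⟨⟨h1, h2⟩, _⟩, _⟩, _⟩, _⟩, _⟩, _⟩ := this
    have h1R : ((0 : ℚ) : ℝ) < ((vget qd k : ℚ) : ℝ) := by exact_mod_cast h1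
    have h2R : ((vget qd k : ℚ) : ℝ) ≤ ((1 : ℚ) : ℝ) := by exact_mod_cast h2
    simp only [Rat.cast_zero, Rat.cast_one] at h1R h2R
    exact ⟨h1R, h2R⟩
  · have := nodek k; simp only [Bool.and_eq_true, decide_eq_true_eq] at this
    obtain ⟨⟨⟨⟨⟨⟨⟨_, _⟩, h1⟩, h2⟩, _⟩, _⟩, _⟩, _⟩ := this
    have h1R : ((0 : ℚ) : ℝ) < ((vget qr k : ℚ) : ℝ) := by exact_mod_cast h1
    have h2R : ((vget qr k : ℚ) : ℝ) ≤ ((1 : ℚ) : ℝ) := by exact_mod_cast h2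
    simp only [Rat.cast_zero, Rat.cast_one] at h1R h2R
    exact ⟨h1R, h2R⟩
  · have := nodek k; simp only [Bool.and_eq_true, decide_eq_true_eq] at this
    obtain ⟨⟨⟨⟨⟨⟨⟨_, _⟩, _⟩, _⟩, h1⟩, h2⟩, _⟩, _⟩ := this
    have h1R : ((c.u k : ℚ) : ℝ) ≤ ((vget qd k ^ 2 * c.u c.apex : ℚ) : ℝ) := by exact_mod_cast h1
    have h2R : ((c.z k : ℚ) : ℝ) ≤ ((vget qd k * c.z c.apex : ℚ) : ℝ) := by exact_mod_cast h2
    simp only [PCert.u, Rat.cast_mul, Rat.cast_pow] at h1R h2R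
    exact ⟨h1R, h2R⟩
  · have := nodek k; simp only [Bool.and_eq_true, decide_eq_true_eq] at this
    obtain ⟨⟨⟨⟨⟨⟨⟨_, _⟩, _⟩, _⟩, _⟩, _⟩, h1⟩, h2⟩ := this
    have h1R : ((c.v k : ℚ) : ℝ) ≤ ((vget qr k ^ 2 * c.u c.apex : ℚ) : ℝ) := by exact_mod_cast h1
    have h2R : ((1 - c.zb k : ℚ) : ℝ) ≤ ((vget qr k * c.z c.apex : ℚ) : ℝ) := by exact_mod_cast h2
    simp only [PCert.u, PCert.v, Rat.cast_mul, Rat.cast_pow, Rat.cast_sub, Rat.cast_one] at h1R h2R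
    exact ⟨h1R, h2R⟩
  · -- the bracket inequality
    set a : Fin c.N := ⟨c.apex, apex_lt hc⟩ with ha
    -- real meanings of the three interval sums
    have eslo : (c.rSlo.expo c.rho) = c.slo := by simp [PowReq.expo, rSlo, tslo_eq hc]
    have eshi : (c.rShi.expo c.rho) = c.shi := by simp [PowReq.expo, rShi, tshi_eq hc]
    have ok1 : c.rSlo.ok = true := by simp [PowReq.ok, rSlo]
    have ok2 : c.rShi.ok = true := by simp [PowReq.ok, rShi]
    -- termwise upper bounds
    have hd : ∀ k < c.N, (|((c.w k : ℚ) : ℝ)| * ((c.v k : ℚ) : ℝ) ^ ((c.slo : ℚ) : ℝ) *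
        ((vget qd k : ℚ) : ℝ) ^ ((ET : ℕ) : ℝ)) * c.S ≤
        ((if k = c.apex then (0 : ℤ) else (mulQ (c.powV k c.rSlo) (|c.w k| * vget qd k ^ ET)).hi : ℤ) : ℝ)
        ∨ k = c.apex := by
      intro k hk
      by_cases hka : k = c.apex
      · exact Or.inr hka
      · left
        rw [if_neg hka]
        have := mem_mulQ (mem_powV (checkNode_of_checkNodes hc hk) hS c.rSlo ok1) (|c.w k| * vget qd k ^ ET)
        rw [eslo] at this
        have := this.2
        rw [Real.rpow_natCast]
        push_cast at this ⊢
        nlinarith [this]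
    have hr : ∀ k < c.N, (|((c.w k : ℚ) : ℝ)| * ((c.u k : ℚ) : ℝ) ^ ((c.slo : ℚ) : ℝ) *
        ((vget qr k : ℚ) : ℝ) ^ ((ET : ℕ) : ℝ)) * c.S ≤
        (((mulQ (c.powU k c.rSlo) (|c.w k| * vget qr k ^ ET)).hi : ℤ) : ℝ) := by
      intro k hk
      have := mem_mulQ (mem_powU (checkNode_of_checkNodes hc hk) hS c.rSlo ok1) (|c.w k| * vget qr k ^ ET)
      rw [eslo] at this
      have := this.2
      rw [Real.rpow_natCast]
      push_cast at this ⊢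
      nlinarith [this]
    have hapex : (((mulQ (c.powV c.apex c.rShi) (c.w c.apex)).lo : ℤ) : ℝ) ≤
        (((c.w c.apex : ℚ) : ℝ) * ((c.v c.apex : ℚ) : ℝ) ^ ((c.shi : ℚ) : ℝ)) * c.S := by
      have := mem_mulQ (mem_powV (checkNode_of_checkNodes hc (apex_lt hc)) hS c.rShi ok2) (c.w c.apex)
      rw [eshi] at this
      have := this.1
      nlinarith [this]
    -- sums as range sums
    have sumD : ∑ k ∈ univ.erase a,
        |c.wR k| * ((1 - c.zR k) * (1 - c.zbR k)) ^ ((c.slo : ℚ) : ℝ) * c.qR qd k ^ ((ET : ℕ) : ℝ) =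
        ∑ k ∈ range c.N, (if k = c.apex then 0 else
          |((c.w k : ℚ) : ℝ)| * ((c.v k : ℚ) : ℝ) ^ ((c.slo : ℚ) : ℝ) * ((vget qd k : ℚ) : ℝ) ^ ((ET : ℕ) : ℝ)) := by
      rw [Finset.sum_range, ← Finset.add_sum_erase _ _ (mem_univ a)]
      simp only [ha, if_true, zero_add]
      refine sum_congr rfl fun k hk => ?_
      have hne : (k : ℕ) ≠ c.apex := fun h => (Finset.ne_of_mem_erase hk) (Fin.ext h)
      simp [hne, wR, zR, zbR, qR, PCert.v]
    have sumR : ∑ k, |c.wR k| * (c.zR k * c.zbR k) ^ ((c.slo : ℚ) : ℝ) * c.qR qr k ^ ((ET : ℕ) : ℝ) =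
        ∑ k ∈ range c.N,
          |((c.w k : ℚ) : ℝ)| * ((c.u k : ℚ) : ℝ) ^ ((c.slo : ℚ) : ℝ) * ((vget qr k : ℚ) : ℝ) ^ ((ET : ℕ) : ℝ) := by
      rw [Finset.sum_range]
      simp [wR, zR, zbR, qR, PCert.u]
    rw [sumD, sumR]
    -- integer side
    have hI : (((rsum c.N fun k => if k = c.apex then (0 : ℤ) else
          (mulQ (c.powV k c.rSlo) (|c.w k| * vget qd k ^ ET)).hi) +
        (rsum c.N fun k => (mulQ (c.powU k c.rSlo) (|c.w k| * vget qr k ^ ET)).hi) : ℤ) : ℝ) ≤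
        (((mulQ (c.powV c.apex c.rShi) (c.w c.apex)).lo : ℤ) : ℝ) := by exact_mod_cast hineq
    rw [rsum_eq_sum, rsum_eq_sum, Int.cast_add, Int.cast_sum, Int.cast_sum] at hI
    -- bound each range sum
    have bD : (∑ k ∈ range c.N, (if k = c.apex then 0 else
          |((c.w k : ℚ) : ℝ)| * ((c.v k : ℚ) : ℝ) ^ ((c.slo : ℚ) : ℝ) * ((vget qd k : ℚ) : ℝ) ^ ((ET : ℕ) : ℝ))) * c.S ≤
        ∑ k ∈ range c.N, ((if k = c.apex then (0 : ℤ) else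
          (mulQ (c.powV k c.rSlo) (|c.w k| * vget qd k ^ ET)).hi : ℤ) : ℝ) := by
      rw [sum_mul]
      refine sum_le_sum fun k hk => ?_
      rw [mem_range] at hk
      rcases hd k hk with h | h
      · by_cases hka : k = c.apex
        · simp [hka]
        · rw [if_neg hka]; exact h
      · simp [h]
    have bR : (∑ k ∈ range c.N,
          |((c.w k : ℚ) : ℝ)| * ((c.u k : ℚ) : ℝ) ^ ((c.slo : ℚ) : ℝ) * ((vget qr k : ℚ) : ℝ) ^ ((ET : ℕ) : ℝ)) * c.S ≤
        ∑ k ∈ range c.N, (((mulQ (c.powU k c.rSlo) (|c.w k| * vget qr k ^ ET)).hi : ℤ) : ℝ) := by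
      rw [sum_mul]
      exact sum_le_sum fun k hk => hr k (mem_range.mp hk)
    have hva : ((1 - c.zR a) * (1 - c.zbR a)) = ((c.v c.apex : ℚ) : ℝ) := by simp [ha, zR, zbR, PCert.v]
    have hwa : c.wR a = ((c.w c.apex : ℚ) : ℝ) := by simp [ha, wR]
    rw [hva, hwa]
    have h1 :
      ((∑ k ∈ range c.N, (if k = c.apex then 0 else
          |((c.w k : ℚ) : ℝ)| * ((c.v k : ℚ) : ℝ) ^ ((c.slo : ℚ) : ℝ) * ((vget qd k : ℚ) : ℝ) ^ ((ET : ℕ) : ℝ))) +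
        ∑ k ∈ range c.N,
          |((c.w k : ℚ) : ℝ)| * ((c.u k : ℚ) : ℝ) ^ ((c.slo : ℚ) : ℝ) * ((vget qr k : ℚ) : ℝ) ^ ((ET : ℕ) : ℝ)) * c.S
        ≤ (((c.w c.apex : ℚ) : ℝ) * ((c.v c.apex : ℚ) : ℝ) ^ ((c.shi : ℚ) : ℝ)) * c.S := by
      rw [add_mul]; linarith [bD, bR, hI, hapex]
    exact le_of_mul_le_mul_right h1 hSR

end PCert

end PointKernel

end Literature.MathematicalPhysics.QuantumFieldTheory.ConformalBootstrap3D

namespace Literature.MathematicalPhysics.QuantumFieldTheory.ConformalBootstrap3D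

namespace PointKernel

open Literature.Analysis.ValidatedNumerics (rsum rall vget vtab vget_vtab vget_of_length_le rsum_eq_sum
  rall_eq_true_iff of_rall)
open Literature.Analysis.ValidatedNumerics.NumericsMP
open Real Finset

/-! ### Head cells (rule (D∞/O2)): `0 ≤ headNumber w z z̄ ℓ a b slo shi n_F false` -/

/-- `Σ_k ⌊P_k · x_k⌋ + ⌊P̃_k · y_k⌋` over four aligned lists. [folklore] -/
def dot2 : List ℚ → List ℤ → List ℚ → List ℤ → ℤ
  | p :: ps, x :: xs, q :: qs, y :: ys => floorMul p x + floorMul q y + dot2 ps xs qs ys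
  | _, _, _, _ => 0

/-- `dot2` as a sum. [folklore] -/
theorem dot2_eq : ∀ (P : List ℚ) (X : List ℤ) (Pt : List ℚ) (Y : List ℤ),
    X.length = P.length → Pt.length = P.length → Y.length = P.length →
    dot2 P X Pt Y = ∑ k ∈ range P.length,
      (floorMul (vget P k) (X.getD k 0) + floorMul (vget Pt k) (Y.getD k 0))
  | [], [], [], [], _, _, _ => by simp [dot2]
  | p :: ps, x :: xs, q :: qs, y :: ys, h1, h2, h3 => by
    rw [dot2, List.length_cons, Finset.sum_range_succ', dot2_eq ps xs qs ys (by simpa using h1)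
      (by simpa using h2) (by simpa using h3)]
    simp only [vget, List.getD_cons_succ, List.getD_cons_zero]
    ring
  | [], _ :: _, _, _, h, _, _ => by simp at h
  | [], _, _ :: _, _, _, h, _ => by simp at h
  | [], _, _, _ :: _, _, _, h => by simp at h
  | _ :: _, [], _, _, h, _, _ => by simp at h
  | _ :: _, _, [], _, _, h, _ => by simp at h
  | _ :: _, _, _, [], _, _, h => by simp at h

/-- all HR levels `0..n` of `(Δ, ℓ)`, newest first (one recursion step per level). [folklore] -/
def hrRowList (Δ : ℚ) (ℓ : ℕ) : ℕ → List (List ℚ)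
  | 0 => [hrRowQ Δ ℓ 0]
  | n + 1 => (vtab (ℓ + n + 2) (hrStepQ Δ ℓ n ((hrRowList Δ ℓ n).headD []))) :: hrRowList Δ ℓ n

/-- head of the row list. [folklore] -/
theorem hrRowList_headD (Δ : ℚ) (ℓ : ℕ) : ∀ n, (hrRowList Δ ℓ n).headD [] = hrRowQ Δ ℓ n
  | 0 => rfl
  | n + 1 => by simp only [hrRowList, List.headD_cons, hrRowList_headD Δ ℓ n]; rfl

/-- entries of the row list. [folklore] -/
theorem hrRowList_getD (Δ : ℚ) (ℓ : ℕ) : ∀ n i, i ≤ n → (hrRowList Δ ℓ n).getD (n - i) [] = hrRowQ Δ ℓ i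
  | 0, i, hi => by
    obtain rfl : i = 0 := by omega
    rfl
  | n + 1, i, hi => by
    rcases Nat.lt_or_ge i (n + 1) with h | h
    · rw [show n + 1 - i = (n - i) + 1 by omega, hrRowList, List.getD_cons_succ]
      exact hrRowList_getD Δ ℓ n i (by omega)
    · obtain rfl : i = n + 1 := by omega
      rw [Nat.sub_self, hrRowList, List.getD_cons_zero, hrRowList_headD]
      rfl

end PointKernel

end Literature.MathematicalPhysics.QuantumFieldTheory.ConformalBootstrap3D

namespace Literature.MathematicalPhysics.QuantumFieldTheory.ConformalBootstrap3D

namespace PointKernel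

open Literature.Analysis.ValidatedNumerics (rsum rall vget vtab vget_vtab vget_of_length_le rsum_eq_sum
  rall_eq_true_iff of_rall)
open Literature.Analysis.ValidatedNumerics.NumericsMP
open Real Finset

namespace PCert

variable (c : PCert)

/-- lower integers of `d_k = w⁺v^shi u^{e_b} − w⁻v^slo u^{e_a}` per node, from `X_A ∋ u^{e_a}`,
`X_B ∋ u^{e_b}` [folklore] -/
def duList (nc : List NC4) (XA XB : List MI) : List ℤ :=
  vtab c.N fun k => (DU c.S (nc.getD k ⟨⟨0,0⟩,⟨0,0⟩,⟨0,0⟩,⟨0,0⟩⟩) (miAt XA k) (miAt XB k)).lo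
/-- lower integers of `d̃_k = w⁻u^shi v^{e_b} − w⁺u^slo v^{e_a}` per node [folklore] -/
def dvList (nc : List NC4) (YA YB : List MI) : List ℤ :=
  vtab c.N fun k => (DV c.S (nc.getD k ⟨⟨0,0⟩,⟨0,0⟩,⟨0,0⟩,⟨0,0⟩⟩) (miAt YA k) (miAt YB k)).lo
/-- shifted tables `⌊u_k^{m'-ℓ/2} D_k⌋`, `m' ≤ n_F` [folklore] -/
def iuTab (D : List ℤ) (ℓ nF : ℕ) : List (List ℤ) :=
  vtab (nF + 1) fun m' => vtab c.N fun k => floorMul (c.u k ^ ((m' : ℤ) - (ℓ / 2 : ℕ))) (D.getD k 0)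
/-- shifted tables `⌊v_k^{m'-ℓ/2} D̃_k⌋`, `m' ≤ n_F` [folklore] -/
def ivTab (D : List ℤ) (ℓ nF : ℕ) : List (List ℤ) :=
  vtab (nF + 1) fun m' => vtab c.N fun k => floorMul (c.v k ^ ((m' : ℤ) - (ℓ / 2 : ℕ))) (D.getD k 0)

/-- the integer lower bound of one summand `q = (n, j)` of the head cell (given the tables) [folklore] -/
def qLo (ℓ : ℕ) (LT LTt : List (List ℚ)) (IU IV : List (List ℤ)) (RA RB : List ℚ)
    (ρ ρ' : ℚ) (n j : ℕ) : ℤ :=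
  if InDescendantRange ℓ n j then
    let m' := (n + ℓ - j) / 2
    let T := dot2 (LT.map fun l => vget l j) (IU.getD m' []) (LTt.map fun l => vget l j) (IV.getD m' [])
    min (floorMul (vget RA j * ρ) T) (floorMul (vget RB j * ρ') T)
  else 0

/-- **Head-cell lower sum** (times `S`) of `headCellBound … (headSet ℓ n_F)` on the cell
`[2e_a, 2e_b]`, from intervals `X_A ∋ u^{e_a}`, `X_B ∋ u^{e_b}`, `Y_A ∋ v^{e_a}`, `Y_B ∋ v^{e_b}`.
[folklore] -/
def cellLo (nc : List NC4) (LT LTt : List (List ℚ)) (ℓ : ℕ) (ea eb : ℚ) (XA XB YA YB : List MI)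
    (nF : ℕ) : ℤ :=
  let IU := c.iuTab (c.duList nc XA XB) ℓ nF
  let IV := c.ivTab (c.dvList nc YA YB) ℓ nF
  let RAs := hrRowList (2 * ea) ℓ nF
  let RBs := hrRowList (2 * eb) ℓ nF
  rsum (nF + 1) fun n =>
    let ρ := pivotProdQ (2 * ea) ℓ n / pivotProdQ (2 * eb) ℓ n
    let ρ' := pivotProdQ (2 * eb) ℓ n / pivotProdQ (2 * ea) ℓ n
    let RA := RAs.getD (nF - n) []
    let RB := RBs.getD (nF - n) []
    rsum (ℓ + nF + 1) fun j => qLo ℓ LT LTt IU IV RA RB ρ ρ' n j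

/-- the side conditions of a head cell: pivots positive, HR coefficients nonnegative on the
head set. [folklore] -/
def cellSideOK (ℓ : ℕ) (ea eb : ℚ) (nF : ℕ) : Bool :=
  decide (Even ℓ) &&
  rall (nF + 1) fun n =>
    decide (0 < pivotProdQ (2 * ea) ℓ n) && decide (0 < pivotProdQ (2 * eb) ℓ n) &&
    rall (ℓ + nF + 1) fun j => decide (0 ≤ hrCoeffQ (2 * ea) ℓ n j) && decide (0 ≤ hrCoeffQ (2 * eb) ℓ n j)

/-- **Head-cell check.** [folklore] -/
def cellOK (nc : List NC4) (LT LTt : List (List ℚ)) (ℓ : ℕ) (ea eb : ℚ) (XA XB YA YB : List MI)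
    (nF : ℕ) : Bool :=
  cellSideOK ℓ ea eb nF && decide (0 ≤ c.cellLo nc LT LTt ℓ ea eb XA XB YA YB nF)

variable {c}

/-- the corner bound at shifted arguments, with the integer shift made explicit. [folklore] -/
theorem tcb_shift_eq (hc : c.checkNodes = true) {ℓ n j m' : ℕ} (hℓ : Even ℓ) (h2 : 2 * m' = n + ℓ - j)
    (hjn : j ≤ n + ℓ) (ea eb : ℚ) :
    termCornerBound c.wR c.zR c.zbR j ((((2 * ea : ℚ)) : ℝ) + (n : ℕ)) ((((2 * eb : ℚ)) : ℝ) + (n : ℕ))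
      ((c.slo : ℚ) : ℝ) ((c.shi : ℚ) : ℝ) =
    ∑ k ∈ range c.N,
      (((zLegendreQ j (c.z k) (c.zb k) : ℚ) : ℝ) * (((c.u k ^ ((m' : ℤ) - (ℓ / 2 : ℕ)) : ℚ) : ℝ) *
        ((((c.wp k : ℚ) : ℝ) * ((c.v k : ℚ) : ℝ) ^ ((c.shi : ℚ) : ℝ)) * ((c.u k : ℚ) : ℝ) ^ ((eb : ℚ) : ℝ) -
         (((c.wm k : ℚ) : ℝ) * ((c.v k : ℚ) : ℝ) ^ ((c.slo : ℚ) : ℝ)) * ((c.u k : ℚ) : ℝ) ^ ((ea : ℚ) : ℝ))) +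
       ((zLegendreQ j (1 - c.z k) (1 - c.zb k) : ℚ) : ℝ) * (((c.v k ^ ((m' : ℤ) - (ℓ / 2 : ℕ)) : ℚ) : ℝ) *
        ((((c.wm k : ℚ) : ℝ) * ((c.u k : ℚ) : ℝ) ^ ((c.shi : ℚ) : ℝ)) * ((c.v k : ℚ) : ℝ) ^ ((eb : ℚ) : ℝ) -
         (((c.wp k : ℚ) : ℝ) * ((c.u k : ℚ) : ℝ) ^ ((c.slo : ℚ) : ℝ)) * ((c.v k : ℚ) : ℝ) ^ ((ea : ℚ) : ℝ)))) := by
  rw [termCornerBound_eq_tcbN, tcbN]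
  refine sum_congr rfl fun k hk => ?_
  rw [mem_range] at hk
  have hn := checkNode_of_checkNodes hc hk
  have hu0 : (0 : ℝ) < ((c.u k : ℚ) : ℝ) := by exact_mod_cast u_pos hn
  have hv0 : (0 : ℝ) < ((c.v k : ℚ) : ℝ) := by exact_mod_cast v_pos hn
  obtain ⟨l2, hl2⟩ := hℓ
  have hl : (ℓ / 2 : ℕ) = l2 := by omega
  have hmR : ((((m' : ℤ) - (ℓ / 2 : ℕ) : ℤ)) : ℝ) = ((n : ℝ) - (j : ℝ)) / 2 := by
    rw [hl]; push_cast
    have : ((2 * m' : ℕ) : ℝ) = ((n + ℓ - j : ℕ) : ℝ) := by rw [h2]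
    push_cast [Nat.cast_sub hjn] at this
    have hl2R : (ℓ : ℝ) = l2 + l2 := by exact_mod_cast hl2
    linarith
  have exA : ((((2 * ea : ℚ) : ℝ) + (n : ℕ)) - (j : ℕ)) / 2 =
      ((ea : ℚ) : ℝ) + ((((m' : ℤ) - (ℓ / 2 : ℕ) : ℤ)) : ℝ) := by
    rw [hmR]; push_cast; ring
  have exB : ((((2 * eb : ℚ) : ℝ) + (n : ℕ)) - (j : ℕ)) / 2 =
      ((eb : ℚ) : ℝ) + ((((m' : ℤ) - (ℓ / 2 : ℕ) : ℤ)) : ℝ) := by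
    rw [hmR]; push_cast; ring
  have hu : ((c.u k : ℚ) : ℝ) = ((c.z k : ℚ) : ℝ) * ((c.zb k : ℚ) : ℝ) := by simp [PCert.u]
  have hv : ((c.v k : ℚ) : ℝ) = (1 - ((c.z k : ℚ) : ℝ)) * (1 - ((c.zb k : ℚ) : ℝ)) := by simp [PCert.v]
  have hwp : ((c.wp k : ℚ) : ℝ) = max ((c.w k : ℚ) : ℝ) 0 := by simp [PCert.wp]
  have hwm : ((c.wm k : ℚ) : ℝ) = max (-((c.w k : ℚ) : ℝ)) 0 := by simp [PCert.wm]
  simp only [zMono, exA, exB, ← hu, ← hv]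
  rw [Real.rpow_add hu0, Real.rpow_add hu0, Real.rpow_add hv0, Real.rpow_add hv0, Real.rpow_intCast,
    Real.rpow_intCast, cast_zLegendreQ, cast_zLegendreQ]
  push_cast
  rw [hu, hv, hwp, hwm]
  ring

/-- **Soundness of one head-cell summand.** [folklore] -/
theorem qLo_le (hc : c.checkNodes = true) {ℓ : ℕ} (hℓ : Even ℓ) (ea eb : ℚ) (XA XB YA YB : List MI)
    (hXA : ∀ k < c.N, MI.mem c.S (((c.u k : ℚ) : ℝ) ^ ((ea : ℚ) : ℝ)) (miAt XA k))
    (hXB : ∀ k < c.N, MI.mem c.S (((c.u k : ℚ) : ℝ) ^ ((eb : ℚ) : ℝ)) (miAt XB k))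
    (hYA : ∀ k < c.N, MI.mem c.S (((c.v k : ℚ) : ℝ) ^ ((ea : ℚ) : ℝ)) (miAt YA k))
    (hYB : ∀ k < c.N, MI.mem c.S (((c.v k : ℚ) : ℝ) ^ ((eb : ℚ) : ℝ)) (miAt YB k))
    (nF : ℕ) {J : ℕ} (hJ : ℓ + nF ≤ J) {n j : ℕ} (hn : n ≤ nF) (hj : j ≤ ℓ + nF)
    (hpa : 0 < pivotProdQ (2 * ea) ℓ n) (hpb : 0 < pivotProdQ (2 * eb) ℓ n)
    (hA : 0 ≤ hrCoeffQ (2 * ea) ℓ n j) (hB : 0 ≤ hrCoeffQ (2 * eb) ℓ n j) :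
    ((qLo ℓ (c.legTabs J) (c.legTabsT J) (c.iuTab (c.duList c.ncTab XA XB) ℓ nF)
        (c.ivTab (c.dvList c.ncTab YA YB) ℓ nF) (hrRowQ (2 * ea) ℓ n) (hrRowQ (2 * eb) ℓ n)
        (pivotProdQ (2 * ea) ℓ n / pivotProdQ (2 * eb) ℓ n) (pivotProdQ (2 * eb) ℓ n / pivotProdQ (2 * ea) ℓ n)
        n j : ℤ) : ℝ) ≤
      c.S * min
        (hrCoeff (((2 * ea : ℚ)) : ℝ) ℓ n j *
            (pivotProd (((2 * ea : ℚ)) : ℝ) ℓ n / pivotProd (((2 * eb : ℚ)) : ℝ) ℓ n) *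
          termCornerBound c.wR c.zR c.zbR j ((((2 * ea : ℚ)) : ℝ) + (n : ℕ)) ((((2 * eb : ℚ)) : ℝ) + (n : ℕ))
            ((c.slo : ℚ) : ℝ) ((c.shi : ℚ) : ℝ))
        (hrCoeff (((2 * eb : ℚ)) : ℝ) ℓ n j *
            (pivotProd (((2 * eb : ℚ)) : ℝ) ℓ n / pivotProd (((2 * ea : ℚ)) : ℝ) ℓ n) *
          termCornerBound c.wR c.zR c.zbR j ((((2 * ea : ℚ)) : ℝ) + (n : ℕ)) ((((2 * eb : ℚ)) : ℝ) + (n : ℕ))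
            ((c.slo : ℚ) : ℝ) ((c.shi : ℚ) : ℝ)) := by
  have hS := S_pos hc
  have hSR : (0 : ℝ) < c.S := by exact_mod_cast hS
  unfold qLo
  by_cases hR : InDescendantRange ℓ n j
  swap
  · rw [if_neg hR, hrCoeff_eq_zero_of_not_inDescendantRange _ hR,
      hrCoeff_eq_zero_of_not_inDescendantRange _ hR]
    simp
  rw [if_pos hR]
  obtain ⟨hR1, hR2, hR3⟩ := hR
  set m' := (n + ℓ - j) / 2 with hm'
  have h2 : 2 * m' = n + ℓ - j := by omega
  have hm'F : m' < nF + 1 := by omega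
  set T := termCornerBound c.wR c.zR c.zbR j ((((2 * ea : ℚ)) : ℝ) + (n : ℕ)) ((((2 * eb : ℚ)) : ℝ) + (n : ℕ))
      ((c.slo : ℚ) : ℝ) ((c.shi : ℚ) : ℝ) with hT
  have hTeq := tcb_shift_eq hc hℓ h2 (by omega) ea eb
  set Tlo := dot2 ((c.legTabs J).map fun l => vget l j) ((c.iuTab (c.duList c.ncTab XA XB) ℓ nF).getD m' [])
      ((c.legTabsT J).map fun l => vget l j) ((c.ivTab (c.dvList c.ncTab YA YB) ℓ nF).getD m' []) with hTlo
  have hIU : (c.iuTab (c.duList c.ncTab XA XB) ℓ nF).getD m' [] =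
      vtab c.N fun k => floorMul (c.u k ^ ((m' : ℤ) - (ℓ / 2 : ℕ))) ((c.duList c.ncTab XA XB).getD k 0) := by
    rw [iuTab, getD_vtab _ _ _ hm'F]
  have hIV : (c.ivTab (c.dvList c.ncTab YA YB) ℓ nF).getD m' [] =
      vtab c.N fun k => floorMul (c.v k ^ ((m' : ℤ) - (ℓ / 2 : ℕ))) ((c.dvList c.ncTab YA YB).getD k 0) := by
    rw [ivTab, getD_vtab _ _ _ hm'F]
  have hTS : (Tlo : ℝ) ≤ T * c.S := by
    have hlen : ((c.legTabs J).map fun l => vget l j).length = c.N := by simp [legTabs, vtab]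
    rw [hTlo, hIU, hIV, dot2_eq _ _ _ _ (by simp [vtab, legTabs]) (by simp [vtab, legTabs, legTabsT])
      (by simp [vtab, legTabs]), hlen, hT, hTeq, sum_mul, Int.cast_sum]
    refine sum_le_sum fun k hk => ?_
    rw [mem_range] at hk
    have hnd := checkNode_of_checkNodes hc hk
    have hjJ : j ≤ J := by omega
    rw [legTabs, legTabsT, vget_map_vtab _ _ _ hk, vget_map_vtab _ _ _ hk, vget_legTab hjJ, vget_legTab hjJ,
      getD_vtab _ _ _ hk, getD_vtab _ _ _ hk]
    have hncd : c.ncTab.getD k ⟨⟨0,0⟩,⟨0,0⟩,⟨0,0⟩,⟨0,0⟩⟩ = c.nc4 k := by rw [ncTab, getD_vtab _ _ _ hk]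
    obtain ⟨m1, m2, m3, m4⟩ := mem_nc4 hc hk
    have hdU := mem_DU hS m1 m2 (hXA k hk) (hXB k hk)
    have hdV := mem_DV hS m3 m4 (hYA k hk) (hYB k hk)
    have eU : (c.duList c.ncTab XA XB).getD k 0 = (DU c.S (c.nc4 k) (miAt XA k) (miAt XB k)).lo := by
      rw [duList, getD_vtab _ _ _ hk, hncd]
    have eV : (c.dvList c.ncTab YA YB).getD k 0 = (DV c.S (c.nc4 k) (miAt YA k) (miAt YB k)).lo := by
      rw [dvList, getD_vtab _ _ _ hk, hncd]
    rw [eU, eV]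
    have i1 := floorMul_le (zpow_nonneg (u_pos hnd).le ((m' : ℤ) - (ℓ / 2 : ℕ))) hdU.1
    have i2 := floorMul_le (zpow_nonneg (v_pos hnd).le ((m' : ℤ) - (ℓ / 2 : ℕ))) hdV.1
    have j1 := floorMul_le (zLegendreQ_nonneg j (x := c.z k) (y := c.zb k) (z_pos hnd).le (zb_pos hnd).le) i1
    have j2 := floorMul_le (zLegendreQ_nonneg j (x := 1 - c.z k) (y := 1 - c.zb k)
      (by linarith [z_lt_one hnd]) (by linarith [zb_lt_one hnd])) i2
    push_cast at j1 j2 ⊢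
    linarith [j1, j2]
  have hρ : ((pivotProdQ (2 * ea) ℓ n / pivotProdQ (2 * eb) ℓ n : ℚ) : ℝ) =
      pivotProd (((2 * ea : ℚ)) : ℝ) ℓ n / pivotProd (((2 * eb : ℚ)) : ℝ) ℓ n := by
    rw [Rat.cast_div, cast_pivotProdQ, cast_pivotProdQ]
  have hρ' : ((pivotProdQ (2 * eb) ℓ n / pivotProdQ (2 * ea) ℓ n : ℚ) : ℝ) =
      pivotProd (((2 * eb : ℚ)) : ℝ) ℓ n / pivotProd (((2 * ea : ℚ)) : ℝ) ℓ n := by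
    rw [Rat.cast_div, cast_pivotProdQ, cast_pivotProdQ]
  have hAq : vget (hrRowQ (2 * ea) ℓ n) j = hrCoeffQ (2 * ea) ℓ n j := rfl
  have hBq : vget (hrRowQ (2 * eb) ℓ n) j = hrCoeffQ (2 * eb) ℓ n j := rfl
  rw [hAq, hBq]
  have cA : 0 ≤ hrCoeffQ (2 * ea) ℓ n j * (pivotProdQ (2 * ea) ℓ n / pivotProdQ (2 * eb) ℓ n) :=
    mul_nonneg hA (by positivity)
  have cB : 0 ≤ hrCoeffQ (2 * eb) ℓ n j * (pivotProdQ (2 * eb) ℓ n / pivotProdQ (2 * ea) ℓ n) :=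
    mul_nonneg hB (by positivity)
  have k1 := floorMul_le cA hTS
  have k2 := floorMul_le cB hTS
  rw [Rat.cast_mul, hρ, cast_hrCoeffQ] at k1
  rw [Rat.cast_mul, hρ', cast_hrCoeffQ] at k2
  have cAR : (0 : ℝ) ≤ hrCoeff (((2 * ea : ℚ)) : ℝ) ℓ n j *
      (pivotProd (((2 * ea : ℚ)) : ℝ) ℓ n / pivotProd (((2 * eb : ℚ)) : ℝ) ℓ n) := by
    have := cA; rw [← Rat.cast_nonneg (K := ℝ), Rat.cast_mul, hρ, cast_hrCoeffQ] at this; exact this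
  have cBR : (0 : ℝ) ≤ hrCoeff (((2 * eb : ℚ)) : ℝ) ℓ n j *
      (pivotProd (((2 * eb : ℚ)) : ℝ) ℓ n / pivotProd (((2 * ea : ℚ)) : ℝ) ℓ n) := by
    have := cB; rw [← Rat.cast_nonneg (K := ℝ), Rat.cast_mul, hρ', cast_hrCoeffQ] at this; exact this
  rw [mul_min_of_nonneg _ _ hSR.le, Int.cast_min]
  refine min_le_min ?_ ?_ <;> nlinarith [k1, k2]

/-- **Soundness of the head-cell check**: `0 ≤ headNumber w z z̄ ℓ (2e_a) (2e_b) slo shi n_F false`.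
[folklore] -/
theorem cell_sound (hc : c.checkNodes = true) {ℓ : ℕ} (ea eb : ℚ) (XA XB YA YB : List MI)
    (hXA : ∀ k < c.N, MI.mem c.S (((c.u k : ℚ) : ℝ) ^ ((ea : ℚ) : ℝ)) (miAt XA k))
    (hXB : ∀ k < c.N, MI.mem c.S (((c.u k : ℚ) : ℝ) ^ ((eb : ℚ) : ℝ)) (miAt XB k))
    (hYA : ∀ k < c.N, MI.mem c.S (((c.v k : ℚ) : ℝ) ^ ((ea : ℚ) : ℝ)) (miAt YA k))
    (hYB : ∀ k < c.N, MI.mem c.S (((c.v k : ℚ) : ℝ) ^ ((eb : ℚ) : ℝ)) (miAt YB k))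
    (nF : ℕ) {J : ℕ} (hJ : ℓ + nF ≤ J)
    (h : c.cellOK c.ncTab (c.legTabs J) (c.legTabsT J) ℓ ea eb XA XB YA YB nF = true) :
    0 ≤ headNumber c.wR c.zR c.zbR ℓ (((2 * ea : ℚ)) : ℝ) (((2 * eb : ℚ)) : ℝ) ((c.slo : ℚ) : ℝ)
      ((c.shi : ℚ) : ℝ) nF false := by
  have hS := S_pos hc
  have hSR : (0 : ℝ) < c.S := by exact_mod_cast hS
  simp only [cellOK, cellSideOK, Bool.and_eq_true, decide_eq_true_eq] at h
  obtain ⟨⟨hℓ, hall⟩, hlo⟩ := h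
  simp only [headNumber, Bool.false_eq_true, ↓reduceIte, headCellBound, headSet, Finset.sum_product]
  have hloR : (0 : ℝ) ≤ (c.cellLo c.ncTab (c.legTabs J) (c.legTabsT J) ℓ ea eb XA XB YA YB nF : ℝ) := by
    exact_mod_cast hlo
  simp only [cellLo, rsum_eq_sum, Int.cast_sum] at hloR
  have key : ∀ n ∈ range (nF + 1), ∀ j ∈ range (ℓ + nF + 1),
      ((qLo ℓ (c.legTabs J) (c.legTabsT J) (c.iuTab (c.duList c.ncTab XA XB) ℓ nF)
        (c.ivTab (c.dvList c.ncTab YA YB) ℓ nF) ((hrRowList (2 * ea) ℓ nF).getD (nF - n) [])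
        ((hrRowList (2 * eb) ℓ nF).getD (nF - n) [])
        (pivotProdQ (2 * ea) ℓ n / pivotProdQ (2 * eb) ℓ n)
        (pivotProdQ (2 * eb) ℓ n / pivotProdQ (2 * ea) ℓ n) n j : ℤ) : ℝ) ≤
      c.S * min
        (hrCoeff (((2 * ea : ℚ)) : ℝ) ℓ n j *
            (pivotProd (((2 * ea : ℚ)) : ℝ) ℓ n / pivotProd (((2 * eb : ℚ)) : ℝ) ℓ n) *
          termCornerBound c.wR c.zR c.zbR j ((((2 * ea : ℚ)) : ℝ) + (n : ℕ)) ((((2 * eb : ℚ)) : ℝ) + (n : ℕ))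
            ((c.slo : ℚ) : ℝ) ((c.shi : ℚ) : ℝ))
        (hrCoeff (((2 * eb : ℚ)) : ℝ) ℓ n j *
            (pivotProd (((2 * eb : ℚ)) : ℝ) ℓ n / pivotProd (((2 * ea : ℚ)) : ℝ) ℓ n) *
          termCornerBound c.wR c.zR c.zbR j ((((2 * ea : ℚ)) : ℝ) + (n : ℕ)) ((((2 * eb : ℚ)) : ℝ) + (n : ℕ))
            ((c.slo : ℚ) : ℝ) ((c.shi : ℚ) : ℝ)) := by
    intro n hn j hj
    rw [mem_range] at hn hj
    have hrow := of_rall hall hn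
    simp only [Bool.and_eq_true, decide_eq_true_eq] at hrow
    obtain ⟨⟨hpa, hpb⟩, hAB⟩ := hrow
    have hab := of_rall hAB hj
    simp only [Bool.and_eq_true, decide_eq_true_eq] at hab
    rw [hrRowList_getD _ _ _ _ (by omega), hrRowList_getD _ _ _ _ (by omega)]
    exact qLo_le hc hℓ ea eb XA XB YA YB hXA hXB hYA hYB nF hJ (by omega) (by omega) hpa hpb hab.1 hab.2
  have := sum_le_sum fun n hn => sum_le_sum fun j hj => key n hn j hj
  simp only [← mul_sum] at this
  nlinarith [this, hloR, hSR]

end PCert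

end PointKernel

end Literature.MathematicalPhysics.QuantumFieldTheory.ConformalBootstrap3D

namespace Literature.MathematicalPhysics.QuantumFieldTheory.ConformalBootstrap3D

namespace PointKernel

open Literature.Analysis.ValidatedNumerics (rsum rall vget vtab vget_vtab vget_of_length_le rsum_eq_sum
  rall_eq_true_iff of_rall)
open Literature.Analysis.ValidatedNumerics.NumericsMP
open Real Finset

/-! ### Chord head cells (rule bit `true`): the four vertex values of the bilinear minorant

`termChordMin` of a head term on `[a+n, b+n] × [slo, shi]` is the least of the four vertex values of
`termChordBound`; at a vertex `(θ, η) ∈ {0,1}²` every signed piece `c r^θ ρ^η` becomes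
`c⁺ f⁺_θ(r) f⁺_η(ρ) − c⁻ f⁻_θ(r) f⁻_η(ρ)` with `f^±_0 = 1`, `f⁺_1(x) = 2 − 1/x`, `f⁻_1(x) = x`,
`r = v^{shi-slo}` (`u^{shi-slo}` reflected), `ρ = u^{(b-a)/2}` (`v^{(b-a)/2}` reflected). -/

/-- reciprocal enclosure: `x ∈ I`, `0 < I.lo` ⟹ `1/x ∈ invMI S I`. [folklore] -/
def invMI (S : ℕ) (I : MI) : MI := ⟨⌊((S : ℚ) * S) / I.hi⌋, ⌈((S : ℚ) * S) / I.lo⌉⟩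

/-- interval soundness of `invMI`. [folklore] -/
theorem mem_invMI {S : ℕ} (hS : 0 < S) {x : ℝ} {I : MI} (hx : MI.mem S x I) (hlo : 0 < I.lo) :
    MI.mem S (1 / x) (invMI S I) := by
  obtain ⟨h1, h2⟩ := hx
  have hSR : (0 : ℝ) < S := by exact_mod_cast hS
  have hloR : (0 : ℝ) < I.lo := by exact_mod_cast hlo
  have hxS : 0 < x * S := lt_of_lt_of_le hloR h1
  have hx0 : 0 < x := by
    by_contra hcon; push Not at hcon; nlinarith
  have hhiR : (0 : ℝ) < I.hi := by linarith
  have e : 1 / x * (S : ℝ) = ((S : ℝ) * S) / (x * S) := by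
    field_simp
  constructor
  · show ((⌊((S : ℚ) * S) / I.hi⌋ : ℤ) : ℝ) ≤ 1 / x * S
    calc ((⌊((S : ℚ) * S) / I.hi⌋ : ℤ) : ℝ) ≤ ((S : ℝ) * S) / I.hi := by
          have h := Int.floor_le (((S : ℚ) * S) / I.hi)
          have : ((⌊((S : ℚ) * S) / I.hi⌋ : ℤ) : ℝ) ≤ ((((S : ℚ) * S) / I.hi : ℚ) : ℝ) := by
            exact_mod_cast h
          simpa using this
      _ ≤ ((S : ℝ) * S) / (x * S) := by gcongr
      _ = 1 / x * S := e.symm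
  · show 1 / x * (S : ℝ) ≤ ((⌈((S : ℚ) * S) / I.lo⌉ : ℤ) : ℝ)
    calc 1 / x * (S : ℝ) = ((S : ℝ) * S) / (x * S) := e
      _ ≤ ((S : ℝ) * S) / I.lo := by gcongr
      _ ≤ ((⌈((S : ℚ) * S) / I.lo⌉ : ℤ) : ℝ) := by
          have h := Int.le_ceil (((S : ℚ) * S) / I.lo)
          have : ((((S : ℚ) * S) / I.lo : ℚ) : ℝ) ≤ ((⌈((S : ℚ) * S) / I.lo⌉ : ℤ) : ℝ) := by
            exact_mod_cast h
          simpa using this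

/-- `2 − 1/x` as an interval [folklore] -/
def twoMinusInv (S : ℕ) (I : MI) : MI := MI.sub (MI.ofInt S 2) (invMI S I)

/-- interval soundness of `twoMinusInv`. [folklore] -/
theorem mem_twoMinusInv {S : ℕ} (hS : 0 < S) {x : ℝ} {I : MI} (hx : MI.mem S x I) (hlo : 0 < I.lo) :
    MI.mem S (2 - 1 / x) (twoMinusInv S I) := by
  have := MI.mem_sub (MI.mem_ofInt S 2) (mem_invMI hS hx hlo)
  simpa [twoMinusInv] using this

/-- vertex selector as a real [folklore] -/
noncomputable def bR (b : Bool) : ℝ := bif b then 1 else 0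
/-- vertex factor of a positive part: `f⁺_0 = 1`, `f⁺_1(r) = 2 − 1/r` [folklore] -/
noncomputable def vfp (b : Bool) (r : ℝ) : ℝ := bif b then 2 - 1 / r else 1
/-- vertex factor of a negative part: `f⁻_0 = 1`, `f⁻_1(r) = r` [folklore] -/
noncomputable def vfm (b : Bool) (r : ℝ) : ℝ := bif b then r else 1

/-- the positive-part vertex factor. [folklore] -/
theorem one_sub_bR_p (b : Bool) (r : ℝ) : 1 - bR b * (1 / r - 1) = vfp b r := by
  cases b <;> simp [bR, vfp]; ring
/-- the negative-part vertex factor. [folklore] -/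
theorem one_sub_bR_m (b : Bool) (r : ℝ) : 1 - bR b * (1 - r) = vfm b r := by
  cases b <;> simp [bR, vfm]

/-- multiply by a vertex factor interval iff the vertex bit is set [folklore] -/
def mulIf (S : ℕ) (b : Bool) (I J : MI) : MI := bif b then MI.mul S I J else I

/-- interval soundness of `mulIf` (positive parts). [folklore] -/
theorem mem_mulIf_p {S : ℕ} (hS : 0 < S) (b : Bool) {x r : ℝ} {I J : MI} (hx : MI.mem S x I)
    (hJ : MI.mem S (2 - 1 / r) J) : MI.mem S (x * vfp b r) (mulIf S b I J) := by
  cases b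
  · simpa [mulIf, vfp] using hx
  · simpa [mulIf, vfp] using MI.mem_mul hS hx hJ

/-- interval soundness of `mulIf` (negative parts). [folklore] -/
theorem mem_mulIf_m {S : ℕ} (hS : 0 < S) (b : Bool) {x r : ℝ} {I J : MI} (hx : MI.mem S x I)
    (hJ : MI.mem S r J) : MI.mem S (x * vfm b r) (mulIf S b I J) := by
  cases b
  · simpa [mulIf, vfm] using hx
  · simpa [mulIf, vfm] using MI.mem_mul hS hx hJ

/-- chord node constants: `w⁺v^{slo}`, `w⁻v^{slo}`, `w⁻u^{slo}`, `w⁺u^{slo}` and the `σ`-vertex factors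
`2 − v^{-δ}`, `v^{δ}`, `2 − u^{-δ}`, `u^{δ}` (`δ = shi − slo`). [folklore] -/
structure NCC where
  pv : MI
  mv : MI
  mu : MI
  pu : MI
  rv1 : MI
  rv0 : MI
  ru1 : MI
  ru0 : MI

namespace PCert

variable (c : PCert)

/-- chord constants of node `k` [folklore] -/
def ncc (k : ℕ) : NCC :=
  ⟨mulQ (c.powV k c.rSlo) (c.wp k), mulQ (c.powV k c.rSlo) (c.wm k),
   mulQ (c.powU k c.rSlo) (c.wm k), mulQ (c.powU k c.rSlo) (c.wp k),
   twoMinusInv c.S (atomMI c.S (c.atomsV.getD k []) c.tdel), atomMI c.S (c.atomsV.getD k []) c.tdel,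
   twoMinusInv c.S (atomMI c.S (c.atomsU.getD k []) c.tdel), atomMI c.S (c.atomsU.getD k []) c.tdel⟩

/-- the table of chord constants [folklore] -/
def nccTab : List NCC := vtab c.N c.ncc

/-- the `δ`-atoms have positive lower ends (reciprocals are taken). [folklore] -/
def nccOK : Bool :=
  rall c.N fun k => decide (0 < (atomMI c.S (c.atomsV.getD k []) c.tdel).lo) &&
    decide (0 < (atomMI c.S (c.atomsU.getD k []) c.tdel).lo)

/-- `δ = shi − slo` as a rational [folklore] -/
def del : ℚ := c.shi - c.slo

variable {c} {k : ℕ}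

/-- the real meaning of the chord constants. [folklore] -/
theorem mem_ncc (hc : c.checkNodes = true) (hn : c.nccOK = true) (hk : k < c.N) :
    MI.mem c.S (((c.wp k : ℚ) : ℝ) * ((c.v k : ℚ) : ℝ) ^ ((c.slo : ℚ) : ℝ)) (c.ncc k).pv ∧
    MI.mem c.S (((c.wm k : ℚ) : ℝ) * ((c.v k : ℚ) : ℝ) ^ ((c.slo : ℚ) : ℝ)) (c.ncc k).mv ∧
    MI.mem c.S (((c.wm k : ℚ) : ℝ) * ((c.u k : ℚ) : ℝ) ^ ((c.slo : ℚ) : ℝ)) (c.ncc k).mu ∧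
    MI.mem c.S (((c.wp k : ℚ) : ℝ) * ((c.u k : ℚ) : ℝ) ^ ((c.slo : ℚ) : ℝ)) (c.ncc k).pu ∧
    MI.mem c.S (2 - 1 / ((c.v k : ℚ) : ℝ) ^ ((c.del : ℚ) : ℝ)) (c.ncc k).rv1 ∧
    MI.mem c.S (((c.v k : ℚ) : ℝ) ^ ((c.del : ℚ) : ℝ)) (c.ncc k).rv0 ∧
    MI.mem c.S (2 - 1 / ((c.u k : ℚ) : ℝ) ^ ((c.del : ℚ) : ℝ)) (c.ncc k).ru1 ∧
    MI.mem c.S (((c.u k : ℚ) : ℝ) ^ ((c.del : ℚ) : ℝ)) (c.ncc k).ru0 := by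
  have hS := S_pos hc
  have hnd := checkNode_of_checkNodes hc hk
  have eslo : (c.rSlo.expo c.rho) = c.slo := by simp [PowReq.expo, rSlo, tslo_eq hc]
  have ok1 : c.rSlo.ok = true := by simp [PowReq.ok, rSlo]
  have hlo := of_rall hn hk
  simp only [Bool.and_eq_true, decide_eq_true_eq] at hlo
  have aV := mem_atomV hnd hS c.tdel
  have aU := mem_atomU hnd hS c.tdel
  rw [tdel_eq hc] at aV aU
  refine ⟨?_, ?_, ?_, ?_, ?_, ?_, ?_, ?_⟩
  · have := mem_mulQ (mem_powV hnd hS c.rSlo ok1) (c.wp k); rw [eslo] at this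
    simpa [ncc, mul_comm] using this
  · have := mem_mulQ (mem_powV hnd hS c.rSlo ok1) (c.wm k); rw [eslo] at this
    simpa [ncc, mul_comm] using this
  · have := mem_mulQ (mem_powU hnd hS c.rSlo ok1) (c.wm k); rw [eslo] at this
    simpa [ncc, mul_comm] using this
  · have := mem_mulQ (mem_powU hnd hS c.rSlo ok1) (c.wp k); rw [eslo] at this
    simpa [ncc, mul_comm] using this
  · exact mem_twoMinusInv hS aV hlo.1
  · exact aV
  · exact mem_twoMinusInv hS aU hlo.2
  · exact aU

end PCert

/-- direct chord vertex number
`∋ (w⁺v^{slo}) x_a f⁺_θ(v^δ) f⁺_η(u^ρ) − (w⁻v^{slo}) x_a f⁻_θ(v^δ) f⁻_η(u^ρ)`. [folklore] -/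
def DUc (S : ℕ) (θ η : Bool) (n : NCC) (xa pu pu1 : MI) : MI :=
  MI.sub (mulIf S η (mulIf S θ (MI.mul S n.pv xa) n.rv1) pu1)
    (mulIf S η (mulIf S θ (MI.mul S n.mv xa) n.rv0) pu)
/-- reflected chord vertex number. [folklore] -/
def DVc (S : ℕ) (θ η : Bool) (n : NCC) (ya pv pv1 : MI) : MI :=
  MI.sub (mulIf S η (mulIf S θ (MI.mul S n.mu ya) n.ru1) pv1)
    (mulIf S η (mulIf S θ (MI.mul S n.pu ya) n.ru0) pv)

/-- interval soundness of `DUc`. [folklore] -/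
theorem mem_DUc {S : ℕ} (hS : 0 < S) (θ η : Bool) {n : NCC} {P M xa r ρ : ℝ} {XA PU PU1 : MI}
    (hP : MI.mem S P n.pv) (hM : MI.mem S M n.mv) (hr1 : MI.mem S (2 - 1 / r) n.rv1)
    (hr0 : MI.mem S r n.rv0) (hxa : MI.mem S xa XA) (hρ1 : MI.mem S (2 - 1 / ρ) PU1)
    (hρ0 : MI.mem S ρ PU) :
    MI.mem S (P * xa * vfp θ r * vfp η ρ - M * xa * vfm θ r * vfm η ρ) (DUc S θ η n XA PU PU1) :=
  MI.mem_sub (mem_mulIf_p hS η (mem_mulIf_p hS θ (MI.mem_mul hS hP hxa) hr1) hρ1)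
    (mem_mulIf_m hS η (mem_mulIf_m hS θ (MI.mem_mul hS hM hxa) hr0) hρ0)

/-- interval soundness of `DVc`. [folklore] -/
theorem mem_DVc {S : ℕ} (hS : 0 < S) (θ η : Bool) {n : NCC} {P M ya r ρ : ℝ} {YA PV PV1 : MI}
    (hP : MI.mem S P n.mu) (hM : MI.mem S M n.pu) (hr1 : MI.mem S (2 - 1 / r) n.ru1)
    (hr0 : MI.mem S r n.ru0) (hya : MI.mem S ya YA) (hρ1 : MI.mem S (2 - 1 / ρ) PV1)
    (hρ0 : MI.mem S ρ PV) :
    MI.mem S (P * ya * vfp θ r * vfp η ρ - M * ya * vfm θ r * vfm η ρ) (DVc S θ η n YA PV PV1) :=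
  MI.mem_sub (mem_mulIf_p hS η (mem_mulIf_p hS θ (MI.mem_mul hS hP hya) hr1) hρ1)
    (mem_mulIf_m hS η (mem_mulIf_m hS θ (MI.mem_mul hS hM hya) hr0) hρ0)

/-- `max (wX) 0 = max w 0 · X` for `X ≥ 0`. [folklore] -/
theorem max_mul_zero_of_nonneg (w X : ℝ) (hX : 0 ≤ X) : max (w * X) 0 = max w 0 * X := by
  rw [max_mul_of_nonneg _ _ hX, zero_mul]

/-- `max (-(wX)) 0 = max (-w) 0 · X` for `X ≥ 0`. [folklore] -/
theorem max_neg_mul_zero_of_nonneg (w X : ℝ) (hX : 0 ≤ X) : max (-(w * X)) 0 = max (-w) 0 * X := by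
  rw [max_mul_of_nonneg _ _ hX, zero_mul, neg_mul]

namespace PCert

variable {c : PCert}

/-- real direct vertex number of node `k`:
`(w⁺v^{slo}) u^{e_a} f⁺_θ(v^δ) f⁺_η(u^{ρ_t}) − (w⁻v^{slo}) u^{e_a} f⁻_θ(v^δ) f⁻_η(u^{ρ_t})` [folklore] -/
noncomputable def dRc (c : PCert) (θ η : Bool) (k : ℕ) (ea ρt : ℚ) : ℝ :=
  (((c.wp k : ℚ) : ℝ) * ((c.v k : ℚ) : ℝ) ^ ((c.slo : ℚ) : ℝ)) * ((c.u k : ℚ) : ℝ) ^ ((ea : ℚ) : ℝ) *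
      vfp θ (((c.v k : ℚ) : ℝ) ^ ((c.del : ℚ) : ℝ)) * vfp η (((c.u k : ℚ) : ℝ) ^ ((ρt : ℚ) : ℝ)) -
    (((c.wm k : ℚ) : ℝ) * ((c.v k : ℚ) : ℝ) ^ ((c.slo : ℚ) : ℝ)) * ((c.u k : ℚ) : ℝ) ^ ((ea : ℚ) : ℝ) *
      vfm θ (((c.v k : ℚ) : ℝ) ^ ((c.del : ℚ) : ℝ)) * vfm η (((c.u k : ℚ) : ℝ) ^ ((ρt : ℚ) : ℝ))

/-- real reflected vertex number of node `k` [folklore] -/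
noncomputable def dRcT (c : PCert) (θ η : Bool) (k : ℕ) (ea ρt : ℚ) : ℝ :=
  (((c.wm k : ℚ) : ℝ) * ((c.u k : ℚ) : ℝ) ^ ((c.slo : ℚ) : ℝ)) * ((c.v k : ℚ) : ℝ) ^ ((ea : ℚ) : ℝ) *
      vfp θ (((c.u k : ℚ) : ℝ) ^ ((c.del : ℚ) : ℝ)) * vfp η (((c.v k : ℚ) : ℝ) ^ ((ρt : ℚ) : ℝ)) -
    (((c.wp k : ℚ) : ℝ) * ((c.u k : ℚ) : ℝ) ^ ((c.slo : ℚ) : ℝ)) * ((c.v k : ℚ) : ℝ) ^ ((ea : ℚ) : ℝ) *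
      vfm θ (((c.u k : ℚ) : ℝ) ^ ((c.del : ℚ) : ℝ)) * vfm η (((c.v k : ℚ) : ℝ) ^ ((ρt : ℚ) : ℝ))

/-- **The vertex values of the chord minorant, factorised.** [folklore] -/
theorem tchord_vertex_eq (hc : c.checkNodes = true) (θ η : Bool) {ℓ n j m' : ℕ} (hℓ : Even ℓ)
    (h2 : 2 * m' = n + ℓ - j) (hjn : j ≤ n + ℓ) (ea ρt : ℚ) :
    termChordBound c.wR c.zR c.zbR j ((c.slo : ℚ) : ℝ) ((c.shi : ℚ) : ℝ) ((((2 * ea : ℚ)) : ℝ) + (n : ℕ))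
      ((((2 * (ea + ρt) : ℚ)) : ℝ) + (n : ℕ)) (bR θ) (bR η) =
    ∑ k ∈ range c.N,
      (((zLegendreQ j (c.z k) (c.zb k) : ℚ) : ℝ) * (((c.u k) ^ ((m' : ℤ) - (ℓ / 2 : ℕ)) : ℚ) : ℝ) *
          c.dRc θ η k ea ρt +
        ((zLegendreQ j (1 - c.z k) (1 - c.zb k) : ℚ) : ℝ) * (((c.v k) ^ ((m' : ℤ) - (ℓ / 2 : ℕ)) : ℚ) : ℝ) *
          c.dRcT θ η k ea ρt) := by
  unfold termChordBound
  rw [Finset.sum_range (n := c.N)]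
  refine sum_congr rfl fun k _ => ?_
  have hk : (k : ℕ) < c.N := k.isLt
  have hn := checkNode_of_checkNodes hc hk
  have hu0 : (0 : ℝ) < ((c.u k : ℚ) : ℝ) := by exact_mod_cast u_pos hn
  have hv0 : (0 : ℝ) < ((c.v k : ℚ) : ℝ) := by exact_mod_cast v_pos hn
  obtain ⟨l2, hl2⟩ := hℓ
  have hl : (ℓ / 2 : ℕ) = l2 := by omega
  have hmR : ((((m' : ℤ) - (ℓ / 2 : ℕ) : ℤ)) : ℝ) = ((n : ℝ) - (j : ℝ)) / 2 := by
    rw [hl]; push_cast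
    have : ((2 * m' : ℕ) : ℝ) = ((n + ℓ - j : ℕ) : ℝ) := by rw [h2]
    push_cast [Nat.cast_sub hjn] at this
    have hl2R : (ℓ : ℝ) = l2 + l2 := by exact_mod_cast hl2
    linarith
  have exA : ((((2 * ea : ℚ) : ℝ) + (n : ℕ)) - (j : ℕ)) / 2 =
      ((ea : ℚ) : ℝ) + ((((m' : ℤ) - (ℓ / 2 : ℕ) : ℤ)) : ℝ) := by
    rw [hmR]; push_cast; ring
  have exW : (((((2 * (ea + ρt) : ℚ)) : ℝ) + (n : ℕ)) - ((((2 * ea : ℚ)) : ℝ) + (n : ℕ))) / 2 =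
      ((ρt : ℚ) : ℝ) := by
    push_cast; ring
  have exD : ((c.shi : ℚ) : ℝ) - ((c.slo : ℚ) : ℝ) = ((c.del : ℚ) : ℝ) := by
    simp [PCert.del]
  have hu : ((c.u k : ℚ) : ℝ) = ((c.z k : ℚ) : ℝ) * ((c.zb k : ℚ) : ℝ) := by simp [PCert.u]
  have hv : ((c.v k : ℚ) : ℝ) = (1 - ((c.z k : ℚ) : ℝ)) * (1 - ((c.zb k : ℚ) : ℝ)) := by simp [PCert.v]
  have hwp : ((c.wp k : ℚ) : ℝ) = max ((c.w k : ℚ) : ℝ) 0 := by simp [PCert.wp]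
  have hwm : ((c.wm k : ℚ) : ℝ) = max (-((c.w k : ℚ) : ℝ)) 0 := by simp [PCert.wm]
  have hzR : c.zR k = ((c.z k : ℚ) : ℝ) := rfl
  have hzbR : c.zbR k = ((c.zb k : ℚ) : ℝ) := rfl
  have hwR : c.wR k = ((c.w k : ℚ) : ℝ) := rfl
  simp only [hzR, hzbR, hwR, zMono, exA, exW, exD, ← hu, ← hv, termChordPiece, one_sub_bR_p, one_sub_bR_m]
  -- the two `max` factorizations
  have hz0 : (0 : ℝ) ≤ ((c.z k : ℚ) : ℝ) := by exact_mod_cast (z_pos hn).le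
  have hzb0 : (0 : ℝ) ≤ ((c.zb k : ℚ) : ℝ) := by exact_mod_cast (zb_pos hn).le
  have hz1 : (0 : ℝ) ≤ 1 - ((c.z k : ℚ) : ℝ) := by
    have : ((c.z k : ℚ) : ℝ) < 1 := by exact_mod_cast z_lt_one hn
    linarith
  have hzb1 : (0 : ℝ) ≤ 1 - ((c.zb k : ℚ) : ℝ) := by
    have : ((c.zb k : ℚ) : ℝ) < 1 := by exact_mod_cast zb_lt_one hn
    linarith
  have P1 := zLegendre_nonneg j hz0 hzb0
  have P2 := zLegendre_nonneg j hz1 hzb1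
  have X1 : 0 ≤ ((c.v k : ℚ) : ℝ) ^ ((c.slo : ℚ) : ℝ) *
      (((c.u k : ℚ) : ℝ) ^ (((ea : ℚ) : ℝ) + ((((m' : ℤ) - (ℓ / 2 : ℕ) : ℤ)) : ℝ)) *
        zLegendre j ((c.z k : ℚ) : ℝ) ((c.zb k : ℚ) : ℝ)) := by positivity
  have X2 : 0 ≤ ((c.u k : ℚ) : ℝ) ^ ((c.slo : ℚ) : ℝ) *
      (((c.v k : ℚ) : ℝ) ^ (((ea : ℚ) : ℝ) + ((((m' : ℤ) - (ℓ / 2 : ℕ) : ℤ)) : ℝ)) *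
        zLegendre j (1 - ((c.z k : ℚ) : ℝ)) (1 - ((c.zb k : ℚ) : ℝ))) := by positivity
  rw [max_mul_zero_of_nonneg _ _ X1, max_neg_mul_zero_of_nonneg _ _ X1, max_neg_mul_zero_of_nonneg _ _ X2,
    neg_neg, max_mul_zero_of_nonneg _ _ X2]
  rw [Real.rpow_add hu0, Real.rpow_add hv0, Real.rpow_intCast, Real.rpow_intCast, cast_zLegendreQ,
    cast_zLegendreQ]
  push_cast
  rw [← hwp, ← hwm, dRc, dRcT]
  ring

end PCert

end PointKernel

end Literature.MathematicalPhysics.QuantumFieldTheory.ConformalBootstrap3D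

namespace Literature.MathematicalPhysics.QuantumFieldTheory.ConformalBootstrap3D

namespace PointKernel

open Literature.Analysis.ValidatedNumerics (rsum rall vget vtab vget_vtab vget_of_length_le rsum_eq_sum
  rall_eq_true_iff of_rall)
open Literature.Analysis.ValidatedNumerics.NumericsMP
open Real Finset

/-- `termChordMin` as the least of the four vertex values. [folklore] -/
theorem termChordMin_eq_bR {N : ℕ} (w z zb : Fin N → ℝ) (j : ℕ) (slo shi Elo Ehi : ℝ) :
    termChordMin w z zb j slo shi Elo Ehi =
      min (min (termChordBound w z zb j slo shi Elo Ehi (bR false) (bR false))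
            (termChordBound w z zb j slo shi Elo Ehi (bR true) (bR false)))
        (min (termChordBound w z zb j slo shi Elo Ehi (bR false) (bR true))
            (termChordBound w z zb j slo shi Elo Ehi (bR true) (bR true))) := by
  simp [termChordMin, bR]

namespace PCert

variable (c : PCert)

/-- lower integers of the direct vertex numbers per node [folklore] -/
def duListC (θ η : Bool) (ncc : List NCC) (t : ℕ) (XA : List MI) : List ℤ :=
  vtab c.N fun k =>
    (DUc c.S θ η (ncc.getD k ⟨⟨0,0⟩,⟨0,0⟩,⟨0,0⟩,⟨0,0⟩,⟨0,0⟩,⟨0,0⟩,⟨0,0⟩,⟨0,0⟩⟩) (miAt XA k)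
      (atomMI c.S (c.atomsU.getD k []) t) (twoMinusInv c.S (atomMI c.S (c.atomsU.getD k []) t))).lo
/-- lower integers of the reflected vertex numbers per node [folklore] -/
def dvListC (θ η : Bool) (ncc : List NCC) (t : ℕ) (YA : List MI) : List ℤ :=
  vtab c.N fun k =>
    (DVc c.S θ η (ncc.getD k ⟨⟨0,0⟩,⟨0,0⟩,⟨0,0⟩,⟨0,0⟩,⟨0,0⟩,⟨0,0⟩,⟨0,0⟩,⟨0,0⟩⟩) (miAt YA k)
      (atomMI c.S (c.atomsV.getD k []) t) (twoMinusInv c.S (atomMI c.S (c.atomsV.getD k []) t))).lo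

variable {c}

/-- the chord summand: least vertex value, then `min(⌊Aρ T⌋, ⌊Bρ' T⌋)`. [folklore] -/
def qLoC (ℓ : ℕ) (LT LTt : List (List ℚ)) (IU00 IU10 IU01 IU11 IV00 IV10 IV01 IV11 : List (List ℤ))
    (RA RB : List ℚ) (ρ ρ' : ℚ) (n j : ℕ) : ℤ :=
  if InDescendantRange ℓ n j then
    let m' := (n + ℓ - j) / 2
    let LTj := LT.map fun l => vget l j
    let LTtj := LTt.map fun l => vget l j
    let T := min (min (dot2 LTj (IU00.getD m' []) LTtj (IV00.getD m' []))
                      (dot2 LTj (IU10.getD m' []) LTtj (IV10.getD m' [])))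
                 (min (dot2 LTj (IU01.getD m' []) LTtj (IV01.getD m' []))
                      (dot2 LTj (IU11.getD m' []) LTtj (IV11.getD m' [])))
    min (floorMul (vget RA j * ρ) T) (floorMul (vget RB j * ρ') T)
  else 0

variable (c)

/-- **Chord head-cell lower sum** (times `S`) of `headChordBound … (headSet ℓ n_F)` on the cell
`[2e_a, 2(e_a + ρ_t)]`, from `X_A ∋ u^{e_a}`, `Y_A ∋ v^{e_a}` and the step atom `t`. [folklore] -/
def cellLoC (ncc : List NCC) (LT LTt : List (List ℚ)) (ℓ : ℕ) (ea : ℚ) (t : ℕ) (XA YA : List MI)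
    (nF : ℕ) : ℤ :=
  let eb := ea + atomExp c.rho t
  let IU00 := c.iuTab (c.duListC false false ncc t XA) ℓ nF
  let IU10 := c.iuTab (c.duListC true false ncc t XA) ℓ nF
  let IU01 := c.iuTab (c.duListC false true ncc t XA) ℓ nF
  let IU11 := c.iuTab (c.duListC true true ncc t XA) ℓ nF
  let IV00 := c.ivTab (c.dvListC false false ncc t YA) ℓ nF
  let IV10 := c.ivTab (c.dvListC true false ncc t YA) ℓ nF
  let IV01 := c.ivTab (c.dvListC false true ncc t YA) ℓ nF
  let IV11 := c.ivTab (c.dvListC true true ncc t YA) ℓ nF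
  let RAs := hrRowList (2 * ea) ℓ nF
  let RBs := hrRowList (2 * eb) ℓ nF
  rsum (nF + 1) fun n =>
    let ρ := pivotProdQ (2 * ea) ℓ n / pivotProdQ (2 * eb) ℓ n
    let ρ' := pivotProdQ (2 * eb) ℓ n / pivotProdQ (2 * ea) ℓ n
    let RA := RAs.getD (nF - n) []
    let RB := RBs.getD (nF - n) []
    rsum (ℓ + nF + 1) fun j => qLoC ℓ LT LTt IU00 IU10 IU01 IU11 IV00 IV10 IV01 IV11 RA RB ρ ρ' n j

/-- per-cell checks of the step atom: positive lower ends (reciprocals) and the exact half conditions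
`u_k^{ρ_t}, v_k^{ρ_t} ≥ 1/2` (hypothesis `hρ` of chord cells). [folklore] -/
def stepOKC (t : ℕ) : Bool :=
  rall c.N fun k => decide (0 < (atomMI c.S (c.atomsU.getD k []) t).lo) &&
    decide (0 < (atomMI c.S (c.atomsV.getD k []) t).lo) &&
    checkHalf (c.u k) (atomExp c.rho t) && checkHalf (c.v k) (atomExp c.rho t)

/-- **Chord head-cell check.** [folklore] -/
def cellOKC (ncc : List NCC) (LT LTt : List (List ℚ)) (ℓ : ℕ) (ea : ℚ) (t : ℕ) (XA YA : List MI)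
    (nF : ℕ) : Bool :=
  cellSideOK ℓ ea (ea + atomExp c.rho t) nF && c.stepOKC t &&
    decide (0 ≤ c.cellLoC ncc LT LTt ℓ ea t XA YA nF)

variable {c}

/-- one vertex: the dot product is `≤ S ·` the vertex value. [folklore] -/
theorem dot2C_le (hc : c.checkNodes = true) (hn : c.nccOK = true) (θ η : Bool) {ℓ n j m' : ℕ}
    (hℓ : Even ℓ) (h2 : 2 * m' = n + ℓ - j) (hjn : j ≤ n + ℓ) (ea : ℚ) (t : ℕ) (hst : c.stepOKC t = true)
    (XA YA : List MI)
    (hXA : ∀ k < c.N, MI.mem c.S (((c.u k : ℚ) : ℝ) ^ ((ea : ℚ) : ℝ)) (miAt XA k))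
    (hYA : ∀ k < c.N, MI.mem c.S (((c.v k : ℚ) : ℝ) ^ ((ea : ℚ) : ℝ)) (miAt YA k))
    (nF : ℕ) (hm'F : m' < nF + 1) {J : ℕ} (hjJ : j ≤ J) :
    ((dot2 ((c.legTabs J).map fun l => vget l j) ((c.iuTab (c.duListC θ η c.nccTab t XA) ℓ nF).getD m' [])
        ((c.legTabsT J).map fun l => vget l j) ((c.ivTab (c.dvListC θ η c.nccTab t YA) ℓ nF).getD m' []) :
        ℤ) : ℝ) ≤
      termChordBound c.wR c.zR c.zbR j ((c.slo : ℚ) : ℝ) ((c.shi : ℚ) : ℝ) ((((2 * ea : ℚ)) : ℝ) + (n : ℕ))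
        ((((2 * (ea + atomExp c.rho t) : ℚ)) : ℝ) + (n : ℕ)) (bR θ) (bR η) * c.S := by
  have hS := S_pos hc
  rw [tchord_vertex_eq hc θ η hℓ h2 hjn ea (atomExp c.rho t)]
  have hIU : (c.iuTab (c.duListC θ η c.nccTab t XA) ℓ nF).getD m' [] =
      vtab c.N fun k => floorMul (c.u k ^ ((m' : ℤ) - (ℓ / 2 : ℕ))) ((c.duListC θ η c.nccTab t XA).getD k 0) := by
    rw [iuTab, getD_vtab _ _ _ hm'F]
  have hIV : (c.ivTab (c.dvListC θ η c.nccTab t YA) ℓ nF).getD m' [] =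
      vtab c.N fun k => floorMul (c.v k ^ ((m' : ℤ) - (ℓ / 2 : ℕ))) ((c.dvListC θ η c.nccTab t YA).getD k 0) := by
    rw [ivTab, getD_vtab _ _ _ hm'F]
  have hlen : ((c.legTabs J).map fun l => vget l j).length = c.N := by simp [legTabs, vtab]
  rw [hIU, hIV, dot2_eq _ _ _ _ (by simp [vtab, legTabs]) (by simp [vtab, legTabs, legTabsT])
    (by simp [vtab, legTabs]), hlen, sum_mul, Int.cast_sum]
  refine sum_le_sum fun k hk => ?_
  rw [mem_range] at hk
  have hnd := checkNode_of_checkNodes hc hk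
  rw [legTabs, legTabsT, vget_map_vtab _ _ _ hk, vget_map_vtab _ _ _ hk, vget_legTab hjJ, vget_legTab hjJ,
    getD_vtab _ _ _ hk, getD_vtab _ _ _ hk]
  have hncd : c.nccTab.getD k ⟨⟨0,0⟩,⟨0,0⟩,⟨0,0⟩,⟨0,0⟩,⟨0,0⟩,⟨0,0⟩,⟨0,0⟩,⟨0,0⟩⟩ = c.ncc k := by
    rw [nccTab, getD_vtab _ _ _ hk]
  obtain ⟨m1, m2, m3, m4, m5, m6, m7, m8⟩ := mem_ncc hc hn hk
  have hstk := of_rall hst hk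
  simp only [Bool.and_eq_true, decide_eq_true_eq] at hstk
  obtain ⟨⟨⟨hloU, hloV⟩, _⟩, _⟩ := hstk
  have aU := mem_atomU hnd hS t
  have aV := mem_atomV hnd hS t
  have hdU := mem_DUc hS θ η m1 m2 m5 m6 (hXA k hk) (mem_twoMinusInv hS aU hloU) aU
  have hdV := mem_DVc hS θ η m3 m4 m7 m8 (hYA k hk) (mem_twoMinusInv hS aV hloV) aV
  have eU : (c.duListC θ η c.nccTab t XA).getD k 0 = (DUc c.S θ η (c.ncc k) (miAt XA k)
      (atomMI c.S (c.atomsU.getD k []) t) (twoMinusInv c.S (atomMI c.S (c.atomsU.getD k []) t))).lo := by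
    rw [duListC, getD_vtab _ _ _ hk, hncd]
  have eV : (c.dvListC θ η c.nccTab t YA).getD k 0 = (DVc c.S θ η (c.ncc k) (miAt YA k)
      (atomMI c.S (c.atomsV.getD k []) t) (twoMinusInv c.S (atomMI c.S (c.atomsV.getD k []) t))).lo := by
    rw [dvListC, getD_vtab _ _ _ hk, hncd]
  rw [eU, eV]
  have i1 := floorMul_le (zpow_nonneg (u_pos hnd).le ((m' : ℤ) - (ℓ / 2 : ℕ))) hdU.1
  have i2 := floorMul_le (zpow_nonneg (v_pos hnd).le ((m' : ℤ) - (ℓ / 2 : ℕ))) hdV.1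
  have j1 := floorMul_le (zLegendreQ_nonneg j (x := c.z k) (y := c.zb k) (z_pos hnd).le (zb_pos hnd).le) i1
  have j2 := floorMul_le (zLegendreQ_nonneg j (x := 1 - c.z k) (y := 1 - c.zb k)
    (by linarith [z_lt_one hnd]) (by linarith [zb_lt_one hnd])) i2
  simp only [dRc, dRcT] at *
  push_cast at j1 j2 ⊢
  linarith [j1, j2]

/-- **Soundness of one chord summand.** [folklore] -/
theorem qLoC_le (hc : c.checkNodes = true) (hn : c.nccOK = true) {ℓ : ℕ} (hℓ : Even ℓ) (ea : ℚ) (t : ℕ)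
    (hst : c.stepOKC t = true) (XA YA : List MI)
    (hXA : ∀ k < c.N, MI.mem c.S (((c.u k : ℚ) : ℝ) ^ ((ea : ℚ) : ℝ)) (miAt XA k))
    (hYA : ∀ k < c.N, MI.mem c.S (((c.v k : ℚ) : ℝ) ^ ((ea : ℚ) : ℝ)) (miAt YA k))
    (nF : ℕ) {J : ℕ} (hJ : ℓ + nF ≤ J) {n j : ℕ} (hnn : n ≤ nF) (hj : j ≤ ℓ + nF)
    (hpa : 0 < pivotProdQ (2 * ea) ℓ n) (hpb : 0 < pivotProdQ (2 * (ea + atomExp c.rho t)) ℓ n)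
    (hA : 0 ≤ hrCoeffQ (2 * ea) ℓ n j) (hB : 0 ≤ hrCoeffQ (2 * (ea + atomExp c.rho t)) ℓ n j) :
    ((qLoC ℓ (c.legTabs J) (c.legTabsT J)
        (c.iuTab (c.duListC false false c.nccTab t XA) ℓ nF) (c.iuTab (c.duListC true false c.nccTab t XA) ℓ nF)
        (c.iuTab (c.duListC false true c.nccTab t XA) ℓ nF) (c.iuTab (c.duListC true true c.nccTab t XA) ℓ nF)
        (c.ivTab (c.dvListC false false c.nccTab t YA) ℓ nF) (c.ivTab (c.dvListC true false c.nccTab t YA) ℓ nF)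
        (c.ivTab (c.dvListC false true c.nccTab t YA) ℓ nF) (c.ivTab (c.dvListC true true c.nccTab t YA) ℓ nF)
        (hrRowQ (2 * ea) ℓ n) (hrRowQ (2 * (ea + atomExp c.rho t)) ℓ n)
        (pivotProdQ (2 * ea) ℓ n / pivotProdQ (2 * (ea + atomExp c.rho t)) ℓ n)
        (pivotProdQ (2 * (ea + atomExp c.rho t)) ℓ n / pivotProdQ (2 * ea) ℓ n) n j : ℤ) : ℝ) ≤
      c.S * min
        (hrCoeff (((2 * ea : ℚ)) : ℝ) ℓ n j *
            (pivotProd (((2 * ea : ℚ)) : ℝ) ℓ n / pivotProd (((2 * (ea + atomExp c.rho t) : ℚ)) : ℝ) ℓ n) *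
          termChordMin c.wR c.zR c.zbR j ((c.slo : ℚ) : ℝ) ((c.shi : ℚ) : ℝ)
            ((((2 * ea : ℚ)) : ℝ) + (n : ℕ)) ((((2 * (ea + atomExp c.rho t) : ℚ)) : ℝ) + (n : ℕ)))
        (hrCoeff (((2 * (ea + atomExp c.rho t) : ℚ)) : ℝ) ℓ n j *
            (pivotProd (((2 * (ea + atomExp c.rho t) : ℚ)) : ℝ) ℓ n / pivotProd (((2 * ea : ℚ)) : ℝ) ℓ n) *
          termChordMin c.wR c.zR c.zbR j ((c.slo : ℚ) : ℝ) ((c.shi : ℚ) : ℝ)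
            ((((2 * ea : ℚ)) : ℝ) + (n : ℕ)) ((((2 * (ea + atomExp c.rho t) : ℚ)) : ℝ) + (n : ℕ))) := by
  have hS := S_pos hc
  have hSR : (0 : ℝ) < c.S := by exact_mod_cast hS
  unfold qLoC
  by_cases hR : InDescendantRange ℓ n j
  swap
  · rw [if_neg hR, hrCoeff_eq_zero_of_not_inDescendantRange _ hR,
      hrCoeff_eq_zero_of_not_inDescendantRange _ hR]
    simp
  rw [if_pos hR]
  obtain ⟨hR1, hR2, hR3⟩ := hR
  set m' := (n + ℓ - j) / 2 with hm'
  have h2 : 2 * m' = n + ℓ - j := by omega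
  have hm'F : m' < nF + 1 := by omega
  have hjJ : j ≤ J := by omega
  set Φ := termChordMin c.wR c.zR c.zbR j ((c.slo : ℚ) : ℝ) ((c.shi : ℚ) : ℝ)
      ((((2 * ea : ℚ)) : ℝ) + (n : ℕ)) ((((2 * (ea + atomExp c.rho t) : ℚ)) : ℝ) + (n : ℕ)) with hΦ
  have v00 := dot2C_le hc hn false false hℓ h2 (by omega) ea t hst XA YA hXA hYA nF hm'F hjJ
  have v10 := dot2C_le hc hn true false hℓ h2 (by omega) ea t hst XA YA hXA hYA nF hm'F hjJ
  have v01 := dot2C_le hc hn false true hℓ h2 (by omega) ea t hst XA YA hXA hYA nF hm'F hjJ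
  have v11 := dot2C_le hc hn true true hℓ h2 (by omega) ea t hst XA YA hXA hYA nF hm'F hjJ
  set T := min (min
      (dot2 ((c.legTabs J).map fun l => vget l j) ((c.iuTab (c.duListC false false c.nccTab t XA) ℓ nF).getD m' [])
        ((c.legTabsT J).map fun l => vget l j) ((c.ivTab (c.dvListC false false c.nccTab t YA) ℓ nF).getD m' []))
      (dot2 ((c.legTabs J).map fun l => vget l j) ((c.iuTab (c.duListC true false c.nccTab t XA) ℓ nF).getD m' [])
        ((c.legTabsT J).map fun l => vget l j) ((c.ivTab (c.dvListC true false c.nccTab t YA) ℓ nF).getD m' [])))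
    (min
      (dot2 ((c.legTabs J).map fun l => vget l j) ((c.iuTab (c.duListC false true c.nccTab t XA) ℓ nF).getD m' [])
        ((c.legTabsT J).map fun l => vget l j) ((c.ivTab (c.dvListC false true c.nccTab t YA) ℓ nF).getD m' []))
      (dot2 ((c.legTabs J).map fun l => vget l j) ((c.iuTab (c.duListC true true c.nccTab t XA) ℓ nF).getD m' [])
        ((c.legTabsT J).map fun l => vget l j) ((c.ivTab (c.dvListC true true c.nccTab t YA) ℓ nF).getD m' [])))
    with hT
  have hTS : (T : ℝ) ≤ Φ * c.S := by
    rw [hΦ, termChordMin_eq_bR, min_mul_of_nonneg _ _ hSR.le, min_mul_of_nonneg _ _ hSR.le,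
      min_mul_of_nonneg _ _ hSR.le, hT]
    push_cast at v00 v10 v01 v11 ⊢
    exact min_le_min (min_le_min v00 v10) (min_le_min v01 v11)
  have hρ : ((pivotProdQ (2 * ea) ℓ n / pivotProdQ (2 * (ea + atomExp c.rho t)) ℓ n : ℚ) : ℝ) =
      pivotProd (((2 * ea : ℚ)) : ℝ) ℓ n / pivotProd (((2 * (ea + atomExp c.rho t) : ℚ)) : ℝ) ℓ n := by
    rw [Rat.cast_div, cast_pivotProdQ, cast_pivotProdQ]
  have hρ' : ((pivotProdQ (2 * (ea + atomExp c.rho t)) ℓ n / pivotProdQ (2 * ea) ℓ n : ℚ) : ℝ) =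
      pivotProd (((2 * (ea + atomExp c.rho t) : ℚ)) : ℝ) ℓ n / pivotProd (((2 * ea : ℚ)) : ℝ) ℓ n := by
    rw [Rat.cast_div, cast_pivotProdQ, cast_pivotProdQ]
  have hAq : vget (hrRowQ (2 * ea) ℓ n) j = hrCoeffQ (2 * ea) ℓ n j := rfl
  have hBq : vget (hrRowQ (2 * (ea + atomExp c.rho t)) ℓ n) j = hrCoeffQ (2 * (ea + atomExp c.rho t)) ℓ n j := rfl
  rw [hAq, hBq]
  have cA : 0 ≤ hrCoeffQ (2 * ea) ℓ n j * (pivotProdQ (2 * ea) ℓ n / pivotProdQ (2 * (ea + atomExp c.rho t)) ℓ n) :=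
    mul_nonneg hA (by positivity)
  have cB : 0 ≤ hrCoeffQ (2 * (ea + atomExp c.rho t)) ℓ n j * (pivotProdQ (2 * (ea + atomExp c.rho t)) ℓ n / pivotProdQ (2 * ea) ℓ n) :=
    mul_nonneg hB (by positivity)
  have k1 := floorMul_le cA hTS
  have k2 := floorMul_le cB hTS
  rw [Rat.cast_mul, hρ, cast_hrCoeffQ] at k1
  rw [Rat.cast_mul, hρ', cast_hrCoeffQ] at k2
  rw [mul_min_of_nonneg _ _ hSR.le, Int.cast_min]
  refine min_le_min ?_ ?_ <;> nlinarith [k1, k2]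

/-- **Soundness of the chord head-cell check**: the number `headNumber … true ≥ 0` AND the half
conditions of the cell width (hypothesis `hρ`). [folklore] -/
theorem cell_soundC (hc : c.checkNodes = true) (hn : c.nccOK = true) {ℓ : ℕ} (ea : ℚ) (t : ℕ)
    (XA YA : List MI)
    (hXA : ∀ k < c.N, MI.mem c.S (((c.u k : ℚ) : ℝ) ^ ((ea : ℚ) : ℝ)) (miAt XA k))
    (hYA : ∀ k < c.N, MI.mem c.S (((c.v k : ℚ) : ℝ) ^ ((ea : ℚ) : ℝ)) (miAt YA k))
    (nF : ℕ) {J : ℕ} (hJ : ℓ + nF ≤ J)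
    (h : c.cellOKC c.nccTab (c.legTabs J) (c.legTabsT J) ℓ ea t XA YA nF = true) :
    0 ≤ headNumber c.wR c.zR c.zbR ℓ (((2 * ea : ℚ)) : ℝ) (((2 * (ea + atomExp c.rho t) : ℚ)) : ℝ)
      ((c.slo : ℚ) : ℝ) ((c.shi : ℚ) : ℝ) nF true ∧
    ∀ i : Fin c.N, 1 / 2 ≤ (c.zR i * c.zbR i) ^
        (((((2 * (ea + atomExp c.rho t) : ℚ)) : ℝ) - (((2 * ea : ℚ)) : ℝ)) / 2) ∧
      1 / 2 ≤ ((1 - c.zR i) * (1 - c.zbR i)) ^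
        (((((2 * (ea + atomExp c.rho t) : ℚ)) : ℝ) - (((2 * ea : ℚ)) : ℝ)) / 2) := by
  have hS := S_pos hc
  have hSR : (0 : ℝ) < c.S := by exact_mod_cast hS
  simp only [cellOKC, cellSideOK, Bool.and_eq_true, decide_eq_true_eq] at h
  obtain ⟨⟨⟨hℓ, hall⟩, hst⟩, hlo⟩ := h
  refine ⟨?_, fun i => ?_⟩
  · simp only [headNumber, ↓reduceIte, headChordBound, headCellSum, headSet, Finset.sum_product]
    have hloR : (0 : ℝ) ≤ (c.cellLoC c.nccTab (c.legTabs J) (c.legTabsT J) ℓ ea t XA YA nF : ℝ) := by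
      exact_mod_cast hlo
    simp only [cellLoC, rsum_eq_sum, Int.cast_sum] at hloR
    have key : ∀ n ∈ range (nF + 1), ∀ j ∈ range (ℓ + nF + 1),
        ((qLoC ℓ (c.legTabs J) (c.legTabsT J)
          (c.iuTab (c.duListC false false c.nccTab t XA) ℓ nF) (c.iuTab (c.duListC true false c.nccTab t XA) ℓ nF)
          (c.iuTab (c.duListC false true c.nccTab t XA) ℓ nF) (c.iuTab (c.duListC true true c.nccTab t XA) ℓ nF)
          (c.ivTab (c.dvListC false false c.nccTab t YA) ℓ nF) (c.ivTab (c.dvListC true false c.nccTab t YA) ℓ nF)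
          (c.ivTab (c.dvListC false true c.nccTab t YA) ℓ nF) (c.ivTab (c.dvListC true true c.nccTab t YA) ℓ nF)
          ((hrRowList (2 * ea) ℓ nF).getD (nF - n) []) ((hrRowList (2 * (ea + atomExp c.rho t)) ℓ nF).getD (nF - n) [])
          (pivotProdQ (2 * ea) ℓ n / pivotProdQ (2 * (ea + atomExp c.rho t)) ℓ n)
          (pivotProdQ (2 * (ea + atomExp c.rho t)) ℓ n / pivotProdQ (2 * ea) ℓ n) n j : ℤ) : ℝ) ≤
        c.S * min
          (hrCoeff (((2 * ea : ℚ)) : ℝ) ℓ n j *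
              (pivotProd (((2 * ea : ℚ)) : ℝ) ℓ n / pivotProd (((2 * (ea + atomExp c.rho t) : ℚ)) : ℝ) ℓ n) *
            termChordMin c.wR c.zR c.zbR j ((c.slo : ℚ) : ℝ) ((c.shi : ℚ) : ℝ)
              ((((2 * ea : ℚ)) : ℝ) + (n : ℕ)) ((((2 * (ea + atomExp c.rho t) : ℚ)) : ℝ) + (n : ℕ)))
          (hrCoeff (((2 * (ea + atomExp c.rho t) : ℚ)) : ℝ) ℓ n j *
              (pivotProd (((2 * (ea + atomExp c.rho t) : ℚ)) : ℝ) ℓ n / pivotProd (((2 * ea : ℚ)) : ℝ) ℓ n) *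
            termChordMin c.wR c.zR c.zbR j ((c.slo : ℚ) : ℝ) ((c.shi : ℚ) : ℝ)
              ((((2 * ea : ℚ)) : ℝ) + (n : ℕ)) ((((2 * (ea + atomExp c.rho t) : ℚ)) : ℝ) + (n : ℕ))) := by
      intro n hn' j hj
      rw [mem_range] at hn' hj
      have hrow := of_rall hall hn'
      simp only [Bool.and_eq_true, decide_eq_true_eq] at hrow
      obtain ⟨⟨hpa, hpb⟩, hAB⟩ := hrow
      have hab := of_rall hAB hj
      simp only [Bool.and_eq_true, decide_eq_true_eq] at hab
      rw [hrRowList_getD _ _ _ _ (by omega), hrRowList_getD _ _ _ _ (by omega)]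
      exact qLoC_le hc hn hℓ ea t hst XA YA hXA hYA nF hJ (by omega) (by omega) hpa hpb hab.1 hab.2
    have := sum_le_sum fun n hn' => sum_le_sum fun j hj => key n hn' j hj
    simp only [← mul_sum] at this
    push_cast at this hloR ⊢
    nlinarith [this, hloR, hSR]
  · have hst' := of_rall hst i.isLt
    simp only [Bool.and_eq_true, decide_eq_true_eq] at hst'
    obtain ⟨⟨_, hU⟩, hV⟩ := hst'
    have e : ((((2 * (ea + atomExp c.rho t) : ℚ)) : ℝ) - (((2 * ea : ℚ)) : ℝ)) / 2 =
        ((atomExp c.rho t : ℚ) : ℝ) := by push_cast; ring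
    have hu : c.zR i * c.zbR i = ((c.u i : ℚ) : ℝ) := by simp [zR, zbR, PCert.u]
    have hv : (1 - c.zR i) * (1 - c.zbR i) = ((c.v i : ℚ) : ℝ) := by simp [zR, zbR, PCert.v]
    rw [e, hu, hv]
    exact ⟨half_le_of_checkHalf hU, half_le_of_checkHalf hV⟩

end PCert

end PointKernel

end Literature.MathematicalPhysics.QuantumFieldTheory.ConformalBootstrap3D

namespace Literature.MathematicalPhysics.QuantumFieldTheory.ConformalBootstrap3D

namespace PointKernel

open Literature.Analysis.ValidatedNumerics (rsum rall vget vtab vget_vtab vget_of_length_le rsum_eq_sum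
  rall_eq_true_iff of_rall)
open Literature.Analysis.ValidatedNumerics.NumericsMP
open Real Finset

/-! ### Head segments: chains of cells along a row, each cell with its rule bit -/

/-- One head segment of row `ℓ`: the first half-end-point request, then per cell its half-width
atom, its `n_F` and its rule bit (`false` = corner, `true` = chord). [folklore] -/
structure HSeg where
  /-- the row `ℓ` -/
  ell : ℕ
  /-- request for `t_0 / 2` -/
  r0 : PowReq
  /-- cell `i` is `[2e_i, 2(e_i + ρ_{steps[i]})]` -/
  steps : List ℕ
  /-- `n_F` of cell `i` -/
  nFs : List ℕ
  /-- rule bit of cell `i` -/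
  bits : List Bool

/-- the cells `(e_a, e_b, n_F, bit)` (half end points) of a chain. [folklore] -/
def cellsOf (rho : List (ℕ × ℕ)) : List ℕ → List ℕ → List Bool → ℚ → List (ℚ × ℚ × ℕ × Bool)
  | t :: steps, nF :: nFs, b :: bits, e =>
    (e, e + atomExp rho t, nF, b) :: cellsOf rho steps nFs bits (e + atomExp rho t)
  | _, _, _, _ => []

/-- the cells of a segment [folklore] -/
def segCells (rho : List (ℕ × ℕ)) (s : HSeg) : List (ℚ × ℚ × ℕ × Bool) :=
  cellsOf rho s.steps s.nFs s.bits (s.r0.expo rho)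

namespace PCert

/-- what a checked head cell `x = (e_a, e_b, n_F, bit)` of row `ℓ` delivers: its table number is
`≥ 0`, and for a chord cell the half conditions of its width (hypothesis `hρ`). [folklore] -/
def CellFact (c : PCert) (ℓ : ℕ) (x : ℚ × ℚ × ℕ × Bool) : Prop :=
  0 ≤ headNumber c.wR c.zR c.zbR ℓ (((2 * x.1 : ℚ)) : ℝ) (((2 * x.2.1 : ℚ)) : ℝ) ((c.slo : ℚ) : ℝ)
      ((c.shi : ℚ) : ℝ) x.2.2.1 x.2.2.2 ∧
  (x.2.2.2 = true → ∀ i : Fin c.N,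
    1 / 2 ≤ (c.zR i * c.zbR i) ^ (((((2 * x.2.1 : ℚ)) : ℝ) - (((2 * x.1 : ℚ)) : ℝ)) / 2) ∧
    1 / 2 ≤ ((1 - c.zR i) * (1 - c.zbR i)) ^ (((((2 * x.2.1 : ℚ)) : ℝ) - (((2 * x.1 : ℚ)) : ℝ)) / 2))

variable (c : PCert)

/-- check every cell of a chain (corner or chord by its bit): structural on the steps. [folklore] -/
def hSegOK (nc : List NC4) (ncc : List NCC) (LT LTt : List (List ℚ)) (J ℓ : ℕ) :
    List ℕ → List ℕ → List Bool → ℚ → List MI → List MI → Bool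
  | t :: steps, nF :: nFs, b :: bits, e, X, Y =>
    let X' := stepAll c.S c.atomsU t X
    let Y' := stepAll c.S c.atomsV t Y
    decide (ℓ + nF ≤ J) &&
      (bif b then c.cellOKC ncc LT LTt ℓ e t X Y nF
        else c.cellOK nc LT LTt ℓ e (e + atomExp c.rho t) X X' Y Y' nF) &&
      hSegOK nc ncc LT LTt J ℓ steps nFs bits (e + atomExp c.rho t) X' Y'
  | _, _, _, _, _, _ => true

variable {c}

/-- **Soundness of a chain of head cells.** [folklore] -/
theorem hSegOK_sound (hc : c.checkNodes = true) (hn : c.nccOK = true) (hAU : c.atomsU.length = c.N)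
    (hAV : c.atomsV.length = c.N) (J ℓ : ℕ) :
    ∀ (steps nFs : List ℕ) (bits : List Bool) (e : ℚ) (X Y : List MI), X.length = c.N → Y.length = c.N →
      (∀ k < c.N, MI.mem c.S (((c.u k : ℚ) : ℝ) ^ ((e : ℚ) : ℝ)) (miAt X k)) →
      (∀ k < c.N, MI.mem c.S (((c.v k : ℚ) : ℝ) ^ ((e : ℚ) : ℝ)) (miAt Y k)) →
      c.hSegOK c.ncTab c.nccTab (c.legTabs J) (c.legTabsT J) J ℓ steps nFs bits e X Y = true →
      ∀ x ∈ cellsOf c.rho steps nFs bits e, c.CellFact ℓ x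
  | [], _, _, _, _, _, _, _, _, _, _, x, hx => by simp [cellsOf] at hx
  | _ :: _, [], _, _, _, _, _, _, _, _, _, x, hx => by simp [cellsOf] at hx
  | _ :: _, _ :: _, [], _, _, _, _, _, _, _, _, x, hx => by simp [cellsOf] at hx
  | t :: steps, nF :: nFs, b :: bits, e, X, Y, hXl, hYl, hX, hY, h, x, hx => by
    simp only [hSegOK, Bool.and_eq_true, decide_eq_true_eq] at h
    obtain ⟨⟨hJ, hcell⟩, hrest⟩ := h
    have hX' := mem_stepAll_U hc hAU t e X hXl hX
    have hY' := mem_stepAll_V hc hAV t e Y hYl hY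
    have hXl' : (stepAll c.S c.atomsU t X).length = c.N := by
      rw [length_stepAll _ _ _ _ (by omega), hXl]
    have hYl' : (stepAll c.S c.atomsV t Y).length = c.N := by
      rw [length_stepAll _ _ _ _ (by omega), hYl]
    simp only [cellsOf, List.mem_cons] at hx
    rcases hx with rfl | hx
    · cases b
      · simp only [cond_false] at hcell
        exact ⟨cell_sound hc e (e + atomExp c.rho t) X _ Y _ hX hX' hY hY' nF hJ hcell,
          fun h => by simp at h⟩
      · simp only [cond_true] at hcell
        have := cell_soundC hc hn e t X Y hX hY nF hJ hcell
        exact ⟨this.1, fun _ => this.2⟩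
    · exact hSegOK_sound hc hn hAU hAV J ℓ steps nFs bits (e + atomExp c.rho t) _ _ hXl' hYl' hX' hY'
        hrest x hx

/-- segment `i` of a table (junk beyond) [folklore] -/
def segAt (hsegs : List HSeg) (i : ℕ) : HSeg := hsegs.getD i ⟨0, ⟨0, 0, 0, 0, 0, 0⟩, [], [], []⟩

variable (c)

/-- **Head block checker**: segments `ilo ≤ i < ihi`, tables of depth `J` computed once. [folklore] -/
def hBlockOK (hsegs : List HSeg) (ilo ihi J : ℕ) : Bool :=
  let nc := c.ncTab
  let ncc := c.nccTab
  let LT := c.legTabs J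
  let LTt := c.legTabsT J
  decide (c.atomsU.length = c.N) && decide (c.atomsV.length = c.N) && c.nccOK &&
  rall (ihi - ilo) fun i =>
    (segAt hsegs (ilo + i)).r0.ok &&
      c.hSegOK nc ncc LT LTt J (segAt hsegs (ilo + i)).ell (segAt hsegs (ilo + i)).steps
        (segAt hsegs (ilo + i)).nFs (segAt hsegs (ilo + i)).bits ((segAt hsegs (ilo + i)).r0.expo c.rho)
        (c.X0 (segAt hsegs (ilo + i)).r0) (c.Y0 (segAt hsegs (ilo + i)).r0)

variable {c}

/-- **Soundness of a head block.** [folklore] -/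
theorem hBlockOK_sound (hc : c.checkNodes = true) (hsegs : List HSeg) (ilo ihi J : ℕ)
    (h : c.hBlockOK hsegs ilo ihi J = true) :
    ∀ i, ilo ≤ i → i < ihi → ∀ x ∈ segCells c.rho (segAt hsegs i), c.CellFact (segAt hsegs i).ell x := by
  intro i hlo hhi x hx
  simp only [hBlockOK, Bool.and_eq_true, decide_eq_true_eq] at h
  obtain ⟨⟨⟨hAU, hAV⟩, hn⟩, hall⟩ := h
  have hi : i - ilo < ihi - ilo := by omega
  have hrow := of_rall hall hi
  simp only [Bool.and_eq_true, show ilo + (i - ilo) = i by omega] at hrow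
  obtain ⟨hok, hrow⟩ := hrow
  have hS := S_pos hc
  exact hSegOK_sound hc hn hAU hAV J _ _ _ _ _ _ _ (by simp [X0, vtab]) (by simp [Y0, vtab])
    (fun k hk => by
      simp only [miAt, X0, getD_vtab _ _ _ hk]
      exact mem_powU (checkNode_of_checkNodes hc hk) hS _ hok)
    (fun k hk => by
      simp only [miAt, Y0, getD_vtab _ _ _ hk]
      exact mem_powV (checkNode_of_checkNodes hc hk) hS _ hok)
    hrow x hx

/-! ### Head rows assembled from segments -/

/-- the cells of row `ℓ`, in order. [folklore] -/
def rowCells (rho : List (ℕ × ℕ)) (hsegs : List HSeg) (ℓ : ℕ) : List (ℚ × ℚ × ℕ × Bool) :=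
  (hsegs.filter fun s => s.ell = ℓ).flatMap (segCells rho)

/-- cell `k` of row `ℓ` (junk beyond) [folklore] -/
def cellAt (rho : List (ℕ × ℕ)) (hsegs : List HSeg) (ℓ k : ℕ) : ℚ × ℚ × ℕ × Bool :=
  (rowCells rho hsegs ℓ).getD k (0, 0, 0, false)
/-- number of cells of row `ℓ` [folklore] -/
def KH (rho : List (ℕ × ℕ)) (hsegs : List HSeg) (ℓ : ℕ) : ℕ := (rowCells rho hsegs ℓ).length
/-- `t_{ℓ,k}` (as a rational): left end of cell `0`, then right ends [folklore] -/
def tHQ (rho : List (ℕ × ℕ)) (hsegs : List HSeg) (ℓ k : ℕ) : ℚ :=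
  if k = 0 then 2 * (cellAt rho hsegs ℓ 0).1 else 2 * (cellAt rho hsegs ℓ (k - 1)).2.1
/-- `t_{ℓ,k}` as a real [folklore] -/
def tH (rho : List (ℕ × ℕ)) (hsegs : List HSeg) (ℓ k : ℕ) : ℝ := ((tHQ rho hsegs ℓ k : ℚ) : ℝ)
/-- `n_F` of cell `k` of row `ℓ` [folklore] -/
def nFH (rho : List (ℕ × ℕ)) (hsegs : List HSeg) (ℓ k : ℕ) : ℕ := (cellAt rho hsegs ℓ k).2.2.1
/-- rule bit of cell `k` of row `ℓ` [folklore] -/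
def bH (rho : List (ℕ × ℕ)) (hsegs : List HSeg) (ℓ k : ℕ) : Bool := (cellAt rho hsegs ℓ k).2.2.2

/-- meta checks of the head rows: contiguity, end points, `n_F` (rules `ht0`, `htℓ`, `hlow`, `hnF`),
odd rows and rows `≥ L` empty. [folklore] -/
def hMetaOK (rho : List (ℕ × ℕ)) (hsegs : List HSeg) (εlo E0 : ℚ) (L : ℕ) : Bool :=
  decide (0 < L) && (hsegs.all fun s => decide (s.ell < L)) &&
  rall L fun ℓ =>
    let cells := rowCells rho hsegs ℓ
    let K := cells.length
    (if ℓ % 2 = 1 then decide (K = 0) else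
      decide (0 < K) &&
      decide (2 * (cells.getD 0 (0, 0, 0, false)).1 = (if ℓ = 0 then εlo else (ℓ : ℚ) + 1)) &&
      decide (2 * (cells.getD (K - 1) (0, 0, 0, false)).2.1 = E0)) &&
    rall K fun k =>
      decide (k + 1 < K → (cells.getD k (0, 0, 0, false)).2.1 = (cells.getD (k + 1) (0, 0, 0, false)).1) &&
      decide ((ℓ : ℚ) + 1 ≤ 2 * (cells.getD k (0, 0, 0, false)).1) &&
      decide (E0 ≤ 2 * (cells.getD k (0, 0, 0, false)).1 + (((cells.getD k (0, 0, 0, false)).2.2.1 : ℚ) + 1))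

/-- rows `≥ L` have no cells. [folklore] -/
theorem rowCells_eq_nil {rho : List (ℕ × ℕ)} {hsegs : List HSeg} {L ℓ : ℕ}
    (h : (hsegs.all fun s => decide (s.ell < L)) = true) (hℓ : L ≤ ℓ) : rowCells rho hsegs ℓ = [] := by
  rw [rowCells, List.flatMap_eq_nil_iff]
  intro s hs
  rw [List.mem_filter] at hs
  rw [List.all_eq_true] at h
  have := h s hs.1
  simp only [decide_eq_true_eq] at this hs
  omega

/-- left end points of the cells are the `t_{ℓ,k}`. [folklore] -/
theorem tHQ_left {rho : List (ℕ × ℕ)} {hsegs : List HSeg} {ℓ k : ℕ}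
    (hcont : ∀ k', k' + 1 < KH rho hsegs ℓ → (cellAt rho hsegs ℓ k').2.1 = (cellAt rho hsegs ℓ (k' + 1)).1)
    (hk : k < KH rho hsegs ℓ) :
    tHQ rho hsegs ℓ k = 2 * (cellAt rho hsegs ℓ k).1 := by
  unfold tHQ
  by_cases h0 : k = 0
  · simp [h0]
  · rw [if_neg h0, hcont (k - 1) (by omega), show k - 1 + 1 = k by omega]

/-- right end points of the cells are the `t_{ℓ,k+1}`. [folklore] -/
theorem tHQ_right (rho : List (ℕ × ℕ)) (hsegs : List HSeg) (ℓ k : ℕ) :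
    tHQ rho hsegs ℓ (k + 1) = 2 * (cellAt rho hsegs ℓ k).2.1 := by
  simp [tHQ]

/-- **The head meta hypotheses from segments**, and: every cell of a row is a cell of a segment
of that row, with the `t_{ℓ,k}` its doubled end points. [folklore] -/
theorem head_hyps (rho : List (ℕ × ℕ)) (hsegs : List HSeg) (εlo E0 : ℚ) (L : ℕ)
    (h : hMetaOK rho hsegs εlo E0 L = true) :
    (tH rho hsegs 0 0 = ((εlo : ℚ) : ℝ) ∧ tH rho hsegs 0 (KH rho hsegs 0) = ((E0 : ℚ) : ℝ)) ∧
    (∀ ℓ, Even ℓ → ℓ ≠ 0 → ℓ < L →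
      tH rho hsegs ℓ 0 = (ℓ : ℝ) + 1 ∧ tH rho hsegs ℓ (KH rho hsegs ℓ) = ((E0 : ℚ) : ℝ)) ∧
    (∀ ℓ k, k < KH rho hsegs ℓ → (ℓ : ℝ) + 1 ≤ tH rho hsegs ℓ k) ∧
    (∀ ℓ k, k < KH rho hsegs ℓ → ((E0 : ℚ) : ℝ) ≤ tH rho hsegs ℓ k + (((nFH rho hsegs ℓ k : ℕ) : ℝ) + 1)) ∧
    (∀ ℓ k, k < KH rho hsegs ℓ →
      tH rho hsegs ℓ k = (((2 * (cellAt rho hsegs ℓ k).1 : ℚ)) : ℝ) ∧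
      tH rho hsegs ℓ (k + 1) = (((2 * (cellAt rho hsegs ℓ k).2.1 : ℚ)) : ℝ) ∧
      ∃ i < hsegs.length, (segAt hsegs i).ell = ℓ ∧ cellAt rho hsegs ℓ k ∈ segCells rho (segAt hsegs i)) := by
  simp only [hMetaOK, Bool.and_eq_true, decide_eq_true_eq] at h
  obtain ⟨⟨h0L, hL⟩, hall⟩ := h
  -- per-row facts
  have rowF : ∀ ℓ < L,
      (ℓ % 2 = 1 → KH rho hsegs ℓ = 0) ∧
      (ℓ % 2 ≠ 1 → 0 < KH rho hsegs ℓ ∧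
        2 * (cellAt rho hsegs ℓ 0).1 = (if ℓ = 0 then εlo else (ℓ : ℚ) + 1) ∧
        2 * (cellAt rho hsegs ℓ (KH rho hsegs ℓ - 1)).2.1 = E0) ∧
      (∀ k < KH rho hsegs ℓ,
        (k + 1 < KH rho hsegs ℓ → (cellAt rho hsegs ℓ k).2.1 = (cellAt rho hsegs ℓ (k + 1)).1) ∧
        (ℓ : ℚ) + 1 ≤ 2 * (cellAt rho hsegs ℓ k).1 ∧
        E0 ≤ 2 * (cellAt rho hsegs ℓ k).1 + (((cellAt rho hsegs ℓ k).2.2.1 : ℚ) + 1)) := by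
    intro ℓ hℓ
    have hrow := of_rall hall hℓ
    simp only [Bool.and_eq_true] at hrow
    obtain ⟨h1, h2⟩ := hrow
    refine ⟨fun hodd => ?_, fun hev => ?_, fun k hk => ?_⟩
    · rw [if_pos hodd] at h1
      simp only [decide_eq_true_eq] at h1
      exact h1
    · rw [if_neg hev] at h1
      simp only [Bool.and_eq_true, decide_eq_true_eq] at h1
      exact ⟨h1.1.1, h1.1.2, h1.2⟩
    · have := of_rall h2 hk
      simp only [Bool.and_eq_true, decide_eq_true_eq] at this
      exact ⟨this.1.1, this.1.2, this.2⟩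
  have KH0 : ∀ ℓ, L ≤ ℓ → KH rho hsegs ℓ = 0 := fun ℓ hℓ => by
    simp [KH, rowCells_eq_nil hL hℓ]
  have ltL : ∀ ℓ k, k < KH rho hsegs ℓ → ℓ < L := fun ℓ k hk => by
    by_contra hcon; have := KH0 ℓ (not_lt.mp hcon); omega
  have hleft : ∀ ℓ k, k < KH rho hsegs ℓ → tHQ rho hsegs ℓ k = 2 * (cellAt rho hsegs ℓ k).1 :=
    fun ℓ k hk => tHQ_left (fun k' hk' => ((rowF ℓ (ltL ℓ k hk)).2.2 k' (by omega)).1 hk') hk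
  refine ⟨?_, fun ℓ hev hne hlt => ?_, fun ℓ k hk => ?_, fun ℓ k hk => ?_, fun ℓ k hk => ?_⟩
  · obtain ⟨hK, hs, he⟩ := (rowF 0 h0L).2.1 (by norm_num)
    rw [if_pos rfl] at hs
    refine ⟨?_, ?_⟩
    · rw [tH, hleft 0 0 hK, hs]
    · rw [tH, show KH rho hsegs 0 = (KH rho hsegs 0 - 1) + 1 by omega, tHQ_right, he]
  · have hev' : ℓ % 2 ≠ 1 := by obtain ⟨r, hr⟩ := hev; omega
    obtain ⟨hK, hs, he⟩ := (rowF ℓ hlt).2.1 hev'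
    refine ⟨?_, ?_⟩
    · rw [tH, hleft ℓ 0 hK, hs, if_neg hne]; push_cast; ring
    · rw [tH, show KH rho hsegs ℓ = (KH rho hsegs ℓ - 1) + 1 by omega, tHQ_right, he]
  · have := ((rowF ℓ (ltL ℓ k hk)).2.2 k hk).2.1
    rw [tH, hleft ℓ k hk]
    have : (((ℓ : ℚ) + 1 : ℚ) : ℝ) ≤ ((2 * (cellAt rho hsegs ℓ k).1 : ℚ) : ℝ) := by
      exact_mod_cast this
    simpa using this
  · have := ((rowF ℓ (ltL ℓ k hk)).2.2 k hk).2.2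
    rw [tH, hleft ℓ k hk, nFH]
    have : ((E0 : ℚ) : ℝ) ≤ ((2 * (cellAt rho hsegs ℓ k).1 +
        (((cellAt rho hsegs ℓ k).2.2.1 : ℚ) + 1) : ℚ) : ℝ) := by exact_mod_cast this
    simpa using this
  · -- the cell `k` of row `ℓ` is a cell of some segment
    refine ⟨by rw [tH, hleft ℓ k hk], by rw [tH, tHQ_right], ?_⟩
    have hxmem : cellAt rho hsegs ℓ k ∈ rowCells rho hsegs ℓ := by
      rw [cellAt, List.getD_eq_getElem _ _ (by simpa [KH] using hk)]
      exact List.getElem_mem _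
    rw [rowCells, List.mem_flatMap] at hxmem
    obtain ⟨s, hs, hxs⟩ := hxmem
    rw [List.mem_filter] at hs
    obtain ⟨hs, hsl⟩ := hs
    simp only [decide_eq_true_eq] at hsl
    obtain ⟨i, hi, rfl⟩ := List.getElem_of_mem hs
    have hseg : segAt hsegs i = hsegs[i] := by
      rw [segAt, List.getD_eq_getElem?_getD, List.getElem?_eq_getElem hi, Option.getD_some]
    exact ⟨i, hi, by rw [hseg, hsl], by rw [hseg]; exact hxs⟩

end PCert

end PointKernel

end Literature.MathematicalPhysics.QuantumFieldTheory.ConformalBootstrap3D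

namespace Literature.MathematicalPhysics.QuantumFieldTheory.ConformalBootstrap3D

namespace PointKernel

open Literature.Analysis.ValidatedNumerics (rsum rall vget vtab vget_vtab vget_of_length_le rsum_eq_sum
  rall_eq_true_iff of_rall)
open Literature.Analysis.ValidatedNumerics.NumericsMP
open Real Finset Set

/-! ### The assembled certificate theorem -/

/-- the box `[slo, shi] × [εlo, E₀)` of a certificate [folklore] -/
def QBox (slo shi εlo E0 : ℚ) : Set (ℝ × ℝ) :=
  {p | (((slo : ℚ) : ℝ) ≤ p.1 ∧ p.1 ≤ ((shi : ℚ) : ℝ)) ∧ (((εlo : ℚ) : ℝ) ≤ p.2 ∧ p.2 < ((E0 : ℚ) : ℝ))}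

/-- the numeric side conditions of the table theorem. [folklore] -/
def paramOK (εlo E0 τ : ℚ) (L ET J : ℕ) : Bool :=
  decide (εlo ≤ 3) && decide (E0 ≤ (L : ℚ) + 1) && decide (τ ≤ 1) && decide (τ ≤ E0) &&
    decide ((ET : ℚ) ≤ (J : ℚ) + τ) && decide (0 < L)

namespace PCert

variable {c : PCert}

/-- **The kernel certificate theorem.** A point certificate whose node / (S) / (O1) / (T) / meta
checks evaluate to `true`, whose head cells (`ℓ < L`, corner or chord) deliver their `CellFact` and
whose (M) boxes (`j < J`) have nonnegative numbers — the two families of facts the block checkers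
`hBlockOK`, `mBlockOK` establish by `decide` (`hBlockOK_sound`, `mBlockOK_sound`) — excludes its box. [cite: HogervorstRychkov2013, §3 eq. (3.6)] -/
theorem boxExcluded_of_kernel (hc : c.checkNodes = true) (hside : c.sideOK = true) (ho1 : c.o1OK = true)
    (qd qr : List ℚ) (ET : ℕ) (hT : c.tOK qd qr ET = true)
    (εlo E0 τ : ℚ) (L J : ℕ) (hpar : paramOK εlo E0 τ L ET J = true)
    (hsegs : List HSeg) (hmetaH : hMetaOK c.rho hsegs εlo E0 L = true)
    (mrows : List MRow) (hmetaM : c.mMetaOK mrows E0 τ ET J = true)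
    (hcells : ∀ i < hsegs.length, ∀ x ∈ segCells c.rho (segAt hsegs i), c.CellFact (segAt hsegs i).ell x)
    (hboxes : ∀ j < J, ∀ m < (rowAt mrows j).steps.length,
      0 ≤ termCornerBound c.wR c.zR c.zbR j (c.eM mrows j m) (c.eM mrows j (m + 1))
        ((c.slo : ℚ) : ℝ) ((c.shi : ℚ) : ℝ)) :
    BoxExcluded (QBox c.slo c.shi εlo E0) := by
  simp only [paramOK, Bool.and_eq_true, decide_eq_true_eq] at hpar
  obtain ⟨⟨⟨⟨⟨hε3, hL⟩, hτ1⟩, hτ0⟩, hJ⟩, hL0⟩ := hpar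
  obtain ⟨hqd, hqr, hdomd, hdomr, hB⟩ := t_hyps hc qd qr ET hT
  obtain ⟨ht0, htℓ, hlow, hnF, hcell⟩ := head_hyps c.rho hsegs εlo E0 L hmetaH
  -- the facts of cell `k` of row `ℓ`
  have hF : ∀ ℓ k, k < KH c.rho hsegs ℓ → c.CellFact ℓ (cellAt c.rho hsegs ℓ k) := by
    intro ℓ k hk
    obtain ⟨-, -, i, hi, hell, hmem⟩ := hcell ℓ k hk
    have := hcells i hi _ hmem
    rwa [hell] at this
  have hhead : ∀ ℓ, (ℓ = 0 ∨ (Even ℓ ∧ ℓ < L)) → ∀ k < KH c.rho hsegs ℓ,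
      0 ≤ headNumber c.wR c.zR c.zbR ℓ (tH c.rho hsegs ℓ k) (tH c.rho hsegs ℓ (k + 1)) ((c.slo : ℚ) : ℝ)
        ((c.shi : ℚ) : ℝ) (nFH c.rho hsegs ℓ k) (bH c.rho hsegs ℓ k) := by
    intro ℓ _ k hk
    obtain ⟨e1, e2, -⟩ := hcell ℓ k hk
    rw [e1, e2, nFH, bH]
    exact (hF ℓ k hk).1
  have hρ : ∀ ℓ k, k < KH c.rho hsegs ℓ → bH c.rho hsegs ℓ k = true → ∀ i : Fin c.N,
      1 / 2 ≤ (c.zR i * c.zbR i) ^ ((tH c.rho hsegs ℓ (k + 1) - tH c.rho hsegs ℓ k) / 2) ∧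
      1 / 2 ≤ ((1 - c.zR i) * (1 - c.zbR i)) ^ ((tH c.rho hsegs ℓ (k + 1) - tH c.rho hsegs ℓ k) / 2) := by
    intro ℓ k hk hb i
    obtain ⟨e1, e2, -⟩ := hcell ℓ k hk
    rw [e1, e2]
    exact (hF ℓ k hk).2 hb i
  have hJR : ((ET : ℕ) : ℝ) ≤ (J : ℝ) + ((τ : ℚ) : ℝ) := by
    have : (((ET : ℚ)) : ℝ) ≤ (((J : ℚ) + τ : ℚ) : ℝ) := by exact_mod_cast hJ
    push_cast at this; exact this
  obtain ⟨he, hρM, hbox⟩ := ruleM_hyps mrows E0 τ ET J hJR hmetaM hboxes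
  refine boxExcluded_of_pointTable_twist (w := c.wR) (z := c.zR) (zb := c.zbR)
    (slo := ((c.slo : ℚ) : ℝ)) (shi := ((c.shi : ℚ) : ℝ)) (εlo := ((εlo : ℚ) : ℝ)) (E₀ := ((E0 : ℚ) : ℝ))
    (ET := ((ET : ℕ) : ℝ)) (τ := ((τ : ℚ) : ℝ))
    ?_ ?_ ?_ ⟨c.apex, apex_lt hc⟩ ?_ (c.qR qd) (c.qR qr) hqd hqr hdomd hdomr
    (fun p hp => hp) (by exact_mod_cast hε3) L (by exact_mod_cast hL) (by exact_mod_cast hτ1)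
    (by exact_mod_cast hτ0) (side_hyp hside) (o1_hyp hc ho1)
    (tH c.rho hsegs) (KH c.rho hsegs) (nFH c.rho hsegs) (bH c.rho hsegs) ht0 htℓ hlow hnF
    hρ hhead (c.eM mrows) (fun j => (rowAt mrows j).steps.length)
    (fun _ _ => false) he hρM hbox hB
  · intro k
    have hn := checkNode_of_checkNodes hc k.2
    exact ⟨by simpa [zR] using (show ((0:ℚ):ℝ) < ((c.z k : ℚ) : ℝ) by exact_mod_cast z_pos hn),
      by simpa [zR] using (show ((c.z k : ℚ) : ℝ) < ((1:ℚ):ℝ) by exact_mod_cast z_lt_one hn)⟩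
  · intro k
    have hn := checkNode_of_checkNodes hc k.2
    exact ⟨by simpa [zbR] using (show ((0:ℚ):ℝ) < ((c.zb k : ℚ) : ℝ) by exact_mod_cast zb_pos hn),
      by simpa [zbR] using (show ((c.zb k : ℚ) : ℝ) < ((1:ℚ):ℝ) by exact_mod_cast zb_lt_one hn)⟩
  · intro k
    have hn := checkNode_of_checkNodes hc k.2
    simpa [zR, zbR] using (show ((c.zb k : ℚ) : ℝ) ≤ ((c.z k : ℚ) : ℝ) by exact_mod_cast zb_le_z hn)
  · simpa [wR] using (show ((0 : ℚ) : ℝ) ≤ ((c.w c.apex : ℚ) : ℝ) by exact_mod_cast w_apex_nonneg hc)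

end PCert

end PointKernel

end Literature.MathematicalPhysics.QuantumFieldTheory.ConformalBootstrap3D
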